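import Literature.NumberTheory.LFunctions.MoebiusWalshCircuits
import Mathlib.Analysis.SpecialFunctions.Trigonometric.Basic
import Mathlib.Analysis.SpecialFunctions.Trigonometric.Bounds
import Mathlib.Analysis.SpecialFunctions.Pow.Real
import Mathlib.Analysis.SpecialFunctions.Log.Base
import Mathlib.Analysis.Complex.Trigonometric
import Mathlib.Analysis.Complex.Circle
import HarnessLib

/-!
# Fourier coefficients of Walsh functions on `ℤ/2ⁿℤ` (Bourgain 2013, §1) — proved

Topic `Literature/NumberTheory/LFunctions`, sibling proofs file of `MoebiusWalshCircuits.lean`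
(named facts `bourgain_moebius_walsh_uniform`, `bourgain_liouville_walsh_uniform`, …). Everything
here is PROVED (theorems only, no named fact); it is the first, self-contained layer of the printed
proof of J. Bourgain, *Möbius–Walsh correlation bounds and an estimate of Mauduit and Rivat*,
J. Anal. Math. 119 (2013) 147–163 = arXiv:1109.2784 [Bourgain2013MoebiusWalsh], namely its §1
"Estimates on Fourier coefficients of Walsh functions" (the part the paper calls
"basically selfcontained"), in the vocabulary of `Literature.NumberTheory.LFunctions.walshSum`:

* `walshSign A x = ∏_{j ∈ A} (1 - 2x_j)` (the weight of `walshSum`, (0.1)) and the normalised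
  Fourier coefficient `walshCoeff A θ = ŵ_A(θ) = 2⁻ⁿ ∑_{x ∈ {0,1}ⁿ} w_A(x) e(θ · val x)`,
  `val x = ∑_j x_j 2^j = bitsToNat (List.ofFn x)` (`bitsToNat_ofFn`), at a real frequency `θ`
  (the paper takes `θ = k/2^λ`).
* (1.2) `norm_walshCoeff_eq_prod`: `|ŵ_A(θ)| = ∏_{j ∉ A} |cos π2^jθ| · ∏_{j ∈ A} |sin π2^jθ|`
  (written `∏_j |cos π(u_j + 2^jθ)|`, `u_j ∈ {0, 1/2}` = `digitPhase`), from the digit-by-digit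
  factorisation `walshCoeff_eq_prod`.
* Lemma 1, first assertion (Fourier inversion) `walshSign_eq_sum_walshCoeff`:
  `w_A(x) = ∑_{k < 2ⁿ} ŵ_A(k/2ⁿ) e(-k val x/2ⁿ)`, with the orthogonality relation
  `sum_eChar_mul_div` and the injectivity of `val` (`bitsToNat_ofFn_injective`).
* Lemma 1, second assertion (1.1) `sum_norm_walshCoeff_le_prod` / `bourgain2013_lemma1`:
  `∑_{k < 2ⁿ} |ŵ_A(k/2ⁿ)| ≤ ∏_{j ∈ A} 2(j+1) ≤ (2n)^{|A|}`, through the DFT of a general function on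
  the cube (`cubeDFT`), the convolution formula `cubeDFT_mul`, `ℓ¹` submultiplicativity
  `sum_norm_cubeDFT_mul_le`, and the single-digit bound `sum_norm_walshCoeff_singleton_le`
  (`‖ĥ_j‖₁ ≤ 2(j+1)`: support on the multiples of `2^{n-j-1}` by the doubling identity
  `abs_sin_two_pow_mul`, Jordan's inequality and the dyadic harmonic bound `sum_Ico_one_div_le`).
* Lemma 2 (1.3) `norm_walshCoeff_pow_four_le` / `bourgain2013_lemma2`:
  `‖ŵ_A‖_∞ ≤ 2 · 2^{-c|A|}`, `c = log₂(27/16)/4` (explicitly `|ŵ_A(θ)|⁴ ≤ (16/27)^{|A|-1}` for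
  EVERY real `θ`): each `i ∈ A`, `i ≥ 1`, is paired with `i - 1`, the squared product of the two
  factors is `≤ 16/27` (AM–GM), and every index lies in at most two pairs.
* Lemma 3 (1.4) `sum_norm_walshCoeff_le` / `bourgain2013_lemma3` (the Mauduit–Rivat `ℓ¹` bound):
  `∑_{k < 2ⁿ} |ŵ_A(k/2ⁿ)| ≤ 2 · 2^{κn}`, `κ = log₂(2 + √2)/4 < 1/2`, uniformly in `A`, by the
  paper's two-digit recursion `S_{n+2} ≤ √(2+√2) S_n` (`cosProdSum_add_two_le`), whose heart is the
  pointwise `key_inequality` (1.6) — proved here for ALL phase sequences, by Cauchy–Schwarz.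
* Lemma 4 (1.7) `sum_norm_walshCoeff_progression_le` / `bourgain2013_lemma4`: for `r ≤ n` and
  `a < 2^r`, `∑_{k < 2ⁿ, k ≡ a (2^r)} |ŵ_A(k/2ⁿ)| ≤ 2 · 2^{κ(n-r)}` — DEVIATION: immediate from Lemma 3
  for arbitrary phase sequences (drop the top `r` factors, absorb `a` into the phases), instead of
  the paper's perturbation argument (1.8)–(1.10).
* Lemma 5, first assertion (1.11) `sum_norm_walshCoeff_le_of_forall_le`: if every element of
  `A` is `≥ m` then `∑_{k < 2ⁿ} |ŵ_A(k/2ⁿ)| ≤ 2(m + 2) · 2^{κ(n-m)}` — STRONGER than the printed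
  `C^{(log λ)²}(2^σ)^{1/2-c}` (`σ = n - m`) and by a shorter road: the low `m` factors form the
  Dirichlet-type kernel `D_m`, whose shifted-grid `ℓ¹` norm is `≤ m + 2`
  (`sum_cosProd_zero_shift_le`, doubling identity + Jordan), the high factors are summed by Lemma 3.
* Lemma 6 (1.24) `sum_Ico_norm_walshCoeff_le` / `sum_Ico_norm_walshCoeff_le_rpow`: for a window
  `J = [a, a+L)`, `1 ≤ L ≤ 2ⁿ`, `∑_{k ∈ J} |ŵ_A(k/2ⁿ)| ≤ 4 L^κ` (keep the top `m` digit factors,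
  `2^m`-periodicity, Lemma 3 with `n` replaced by `m`).
* The bridge to exponential sums ((3.2), (3.12)): `walshSum_eq_sum_walshCoeff_mul_dyadicExpSum`
  (`∑_x g(x) w_A(x) = ∑_k ŵ_A(k/2ⁿ) G(-k/2ⁿ)`, `G(θ) = ∑_{m<2ⁿ} g(m) e(θm)` = `dyadicExpSum`) and
  `abs_walshSum_le_of_dyadicExpSum_le`: a uniform bound `|G(-k/2ⁿ)| ≤ M` gives
  `|∑_x g(x) w_A(x)| ≤ 2 · 2^{κn} · M` for every `A`. To beat the factor `2^{κn}` this way one needs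
  a power saving `M ≤ 2^{(1-δ)n}` with `δ > κ ≈ 0.44` in the exponential sums of `g`, out of reach
  for `μ`, `λ` unconditionally (the paper uses the bridge under GRH via Baker–Harman,
  (3.11)–(3.12), and inside the type-I analysis of §3); hence the unconditional proof needs §2–§3.

What is NOT here (next layers of the printed proof, see the seat's NOTES): the second half of
Lemma 5 (the Fourier-localised substitute `W_A`, (1.12)–(1.13), via (1.18)–(1.23)), the type-II
analysis of §2, the type-I analysis and the
Mauduit–Rivat combinatorial reduction of §3, and B. Green's small-weight estimate
(`green_liouville_fourierWalsh`, an unproved named fact of `MoebiusWalshCircuits.lean`) which the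
paper invokes for `|A| ≤ λ^{1/2}/H` ((2.32)). No statement of `MoebiusWalshCircuits.lean` is
discharged yet.

Conventions: `e(t) = exp(2πit)` is `eChar`; our `ŵ_A(θ)` carries `e(+θ val x)`, so inversion reads
with `e(-k val x/2ⁿ)` (the paper is not consistent about this sign; all bounds are on absolute
values and `|ŵ_A(-θ)| = |ŵ_A(θ)|`). Sub-namespace `MoebiusWalsh` (object name) to keep the short
helper names (`eChar`, `cosProd`, …) out of the crowded topic namespace.

## References

* J. Bourgain, *Möbius–Walsh correlation bounds and an estimate of Mauduit and Rivat*,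
  J. Anal. Math. 119 (2013), 147–163; arXiv:1109.2784, §1 (Lemmas 1–4, 5 (1.11) and 6,
  (1.0)–(1.7), (1.11), (1.24)), §3 ((3.2), (3.12)). [Bourgain2013MoebiusWalsh]
* C. Mauduit, J. Rivat, *Sur un problème de Gelfond: la somme des chiffres des nombres premiers*,
  Ann. of Math. 171 (2010), 1591–1646 (the origin of the `ℓ¹` estimate). [cited through Bourgain]
-/

noncomputable section

open Finset Real
open Literature.Computability.Complexity

namespace Literature.NumberTheory.LFunctions.MoebiusWalsh

/-! ### Binary digits -/

/-- The value of the digit vector `x : Fin n → Bool` (least significant digit first) is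
`∑_j x_j 2^j`. [folklore] -/
theorem bitsToNat_ofFn {n : ℕ} (x : Fin n → Bool) :
    bitsToNat (List.ofFn x) = ∑ j : Fin n, (x j).toNat * 2 ^ (j : ℕ) := by
  induction n with
  | zero => simp
  | succ n ih =>
    rw [List.ofFn_succ, bitsToNat_cons, ih, Fin.sum_univ_succ]
    simp only [Fin.val_zero, pow_zero, mul_one, Fin.val_succ, pow_succ]
    rw [Finset.mul_sum]
    congr 1
    refine Finset.sum_congr rfl fun j _ => ?_
    ring

/-! ### The additive character `e(t) = exp(2πit)` -/

/-- `e(t) = exp(2π i t)`, i.e. Mathlib's `Real.fourierChar` `𝐞 t` read in `ℂ` (definitionally: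
`eChar_eq_fourierChar`). Deliberately a local copy of the one-line definition also found as
`Literature.NumberTheory.Sieve.eChar` (`LinearEquationsInPrimesCircleObstruction.lean`, same normal
form): that module sits on top of the Green–Tao `U²`-inverse files and is not imported into this
elementary file. [folklore] -/
def eChar (t : ℝ) : ℂ := Complex.exp ((2 * π * t : ℝ) * Complex.I)

/-- `eChar t` is Mathlib's additive character `𝐞 = Real.fourierChar` coerced to `ℂ`. [folklore] -/
theorem eChar_eq_fourierChar (t : ℝ) : eChar t = ((Real.fourierChar t : Circle) : ℂ) := rfl

/-- `|e(t)| = 1`. [folklore] -/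
theorem norm_eChar (t : ℝ) : ‖eChar t‖ = 1 := Complex.norm_exp_ofReal_mul_I _

/-- `e(s + t) = e(s) e(t)`. [folklore] -/
theorem eChar_add (s t : ℝ) : eChar (s + t) = eChar s * eChar t := by
  unfold eChar; rw [← Complex.exp_add]; congr 1; push_cast; ring

/-- `e(0) = 1`. [folklore] -/
@[simp] theorem eChar_zero : eChar 0 = 1 := by simp [eChar]

/-- `e(∑ f) = ∏ e(f)`. [folklore] -/
theorem eChar_sum {ι : Type*} (s : Finset ι) (f : ι → ℝ) :
    eChar (∑ i ∈ s, f i) = ∏ i ∈ s, eChar (f i) := by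
  classical
  induction s using Finset.induction_on with
  | empty => simp
  | insert a s ha ih => rw [Finset.sum_insert ha, Finset.prod_insert ha, eChar_add, ih]

/-- `e(m) = 1` for an integer `m`. [folklore] -/
theorem eChar_intCast (m : ℤ) : eChar m = 1 := by
  unfold eChar
  have : ((2 * π * (m : ℝ) : ℝ) : ℂ) * Complex.I = m * (2 * π * Complex.I) := by push_cast; ring
  rw [this, Complex.exp_int_mul_two_pi_mul_I]

/-- `e(t + m) = e(t)` for an integer `m`. [folklore] -/
theorem eChar_add_intCast (t : ℝ) (m : ℤ) : eChar (t + m) = eChar t := by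
  rw [eChar_add, eChar_intCast, mul_one]

/-- `|1 + e(t)| = 2|cos πt|`. [folklore] -/
theorem norm_one_add_eChar (t : ℝ) : ‖1 + eChar t‖ = 2 * |Real.cos (π * t)| := by
  have h : (1 : ℂ) + eChar t =
      Complex.exp (((π * t : ℝ) : ℂ) * Complex.I) * (2 * Complex.cos ((π * t : ℝ) : ℂ)) := by
    rw [Complex.two_cos, mul_add, ← Complex.exp_add, ← Complex.exp_add, add_comm]
    unfold eChar
    congr 1
    · congr 1; push_cast; ring
    · rw [← Complex.exp_zero]; congr 1; ring
  rw [h, norm_mul, Complex.norm_exp_ofReal_mul_I, one_mul, ← Complex.ofReal_cos]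
  have : (2 : ℂ) * ((Real.cos (π * t) : ℝ) : ℂ) = ((2 * Real.cos (π * t) : ℝ) : ℂ) := by push_cast; ring
  rw [this, Complex.norm_real, Real.norm_eq_abs, abs_mul, abs_two]

/-- `e(1/2) = -1`. [folklore] -/
theorem eChar_one_half : eChar (1 / 2) = -1 := by
  unfold eChar
  rw [show ((2 * π * (1 / 2 : ℝ) : ℝ) : ℂ) * Complex.I = π * Complex.I by push_cast; ring,
    Complex.exp_pi_mul_I]

/-- `e(t + 1/2) = -e(t)`. [folklore] -/
theorem eChar_add_one_half (t : ℝ) : eChar (t + 1 / 2) = -eChar t := by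
  rw [eChar_add, eChar_one_half, mul_neg_one]

/-- `|1 - e(t)| = 2|sin πt|`. [folklore] -/
theorem norm_one_sub_eChar (t : ℝ) : ‖1 - eChar t‖ = 2 * |Real.sin (π * t)| := by
  rw [sub_eq_add_neg, ← eChar_add_one_half, norm_one_add_eChar, mul_add,
    show π * (1 / 2 : ℝ) = π / 2 by ring, Real.cos_add_pi_div_two, abs_neg]

/-! ### Walsh functions and their Fourier coefficients on `ℤ/2ⁿℤ` -/

/-- The Walsh function `w_A(x) = ∏_{j ∈ A} (1 - 2x_j) ∈ {±1}` of the digit vector `x`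
(Bourgain 2013, (0.1)); this is the weight in `walshSum`. [cite: Bourgain2013MoebiusWalsh, (0.1)] -/
def walshSign {n : ℕ} (A : Finset (Fin n)) (x : Fin n → Bool) : ℝ :=
  ∏ j ∈ A, (if x j = true then (-1 : ℝ) else 1)

/-- `walshSum g A = ∑_x g(val x) w_A(x)`. [folklore] -/
theorem walshSum_eq_sum_walshSign {n : ℕ} (g : ℕ → ℤ) (A : Finset (Fin n)) :
    walshSum g A = ∑ x : Fin n → Bool, (g (bitsToNat (List.ofFn x)) : ℝ) * walshSign A x := rfl

/-- `|w_A(x)| = 1`. [folklore] -/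
theorem abs_walshSign {n : ℕ} (A : Finset (Fin n)) (x : Fin n → Bool) : |walshSign A x| = 1 := by
  unfold walshSign
  rw [Finset.abs_prod]
  exact Finset.prod_eq_one fun j _ => by split_ifs <;> simp

/-- The digit phase `u_j = 1/2` if `j ∈ A` and `u_j = 0` otherwise (Bourgain 2013, proof of
Lemma 3: "`u_i = 1` if `i ∈ A` and `u_i = 0` if `i ∉ A`", there inside `cos π(u_i/2 + ·)`).
[cite: Bourgain2013MoebiusWalsh, (1.5)] -/
def digitPhase {n : ℕ} (A : Finset (Fin n)) (j : Fin n) : ℝ := if j ∈ A then 1 / 2 else 0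

/-- The normalised Fourier coefficient of the Walsh function `w_A` on `ℤ/2ⁿℤ` at the real
frequency `θ`: `ŵ_A(θ) = 2⁻ⁿ ∑_{x ∈ {0,1}ⁿ} w_A(x) e(θ · val x)`, `val x = ∑_j x_j 2^j`
(Bourgain 2013, Lemma 1 and the display after it, where `θ = k/2^λ`).
[cite: Bourgain2013MoebiusWalsh, Lemma 1] -/
def walshCoeff {n : ℕ} (A : Finset (Fin n)) (θ : ℝ) : ℂ :=
  ((2 : ℂ) ^ n)⁻¹ * ∑ x : Fin n → Bool,
    (walshSign A x : ℂ) * eChar (θ * bitsToNat (List.ofFn x))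

/-- The one-digit factor of `w_A(x) e(θ · val x)`. [folklore] -/
def digitFactor {n : ℕ} (A : Finset (Fin n)) (θ : ℝ) (j : Fin n) (b : Bool) : ℂ :=
  (if j ∈ A then (if b = true then (-1 : ℂ) else 1) else 1) * eChar (θ * (b.toNat * 2 ^ (j : ℕ)))

/-- The digit-`0` factor is `1`. [folklore] -/
@[simp] theorem digitFactor_false {n : ℕ} (A : Finset (Fin n)) (θ : ℝ) (j : Fin n) :
    digitFactor A θ j false = 1 := by
  simp [digitFactor]

/-- The digit-`1` factor is `± e(2^j θ)`. [folklore] -/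
@[simp] theorem digitFactor_true {n : ℕ} (A : Finset (Fin n)) (θ : ℝ) (j : Fin n) :
    digitFactor A θ j true = (if j ∈ A then (-1 : ℂ) else 1) * eChar (θ * 2 ^ (j : ℕ)) := by
  simp [digitFactor]

/-- `w_A(x) e(θ · val x) = ∏_j digitFactor_j(x_j)`. [folklore] -/
theorem walshSign_mul_eChar_eq_prod {n : ℕ} (A : Finset (Fin n)) (θ : ℝ) (x : Fin n → Bool) :
    (walshSign A x : ℂ) * eChar (θ * bitsToNat (List.ofFn x)) =
      ∏ j : Fin n, digitFactor A θ j (x j) := by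
  unfold digitFactor
  rw [Finset.prod_mul_distrib]
  congr 1
  · unfold walshSign
    push_cast
    rw [← Finset.prod_ite_mem_eq]
    refine Finset.prod_congr rfl fun j _ => ?_
    split_ifs <;> simp
  · rw [← eChar_sum, bitsToNat_ofFn]
    congr 1
    push_cast
    rw [Finset.mul_sum]

/-- **Product formula** (Bourgain 2013, display before (1.2)):
`ŵ_A(θ) = ∏_{j ∉ A} (1 + e(2^j θ))/2 · ∏_{j ∈ A} (1 - e(2^j θ))/2`, written as one product.
[cite: Bourgain2013MoebiusWalsh, (1.2)] -/
theorem walshCoeff_eq_prod {n : ℕ} (A : Finset (Fin n)) (θ : ℝ) :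
    walshCoeff A θ = ∏ j : Fin n,
      ((1 + (if j ∈ A then (-1 : ℂ) else 1) * eChar (θ * 2 ^ (j : ℕ))) / 2) := by
  unfold walshCoeff
  simp_rw [walshSign_mul_eChar_eq_prod]
  rw [← Fintype.prod_sum]
  rw [Finset.prod_div_distrib, Finset.prod_const, Finset.card_univ, Fintype.card_fin,
    div_eq_inv_mul]
  congr 1
  refine Finset.prod_congr rfl fun j _ => ?_
  rw [Fintype.sum_bool, digitFactor_true, digitFactor_false, add_comm]

/-- **Modulus of the Fourier coefficients** (Bourgain 2013, (1.2)):
`|ŵ_A(θ)| = ∏_{j ∉ A} |cos π 2^j θ| ∏_{j ∈ A} |sin π 2^j θ| = ∏_j |cos π(u_j + 2^j θ)|` with the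
digit phases `u_j ∈ {0, 1/2}`. [cite: Bourgain2013MoebiusWalsh, (1.2)] -/
theorem norm_walshCoeff_eq_prod {n : ℕ} (A : Finset (Fin n)) (θ : ℝ) :
    ‖walshCoeff A θ‖ = ∏ j : Fin n, |Real.cos (π * (digitPhase A j + 2 ^ (j : ℕ) * θ))| := by
  rw [walshCoeff_eq_prod, Complex.norm_prod]
  refine Finset.prod_congr rfl fun j _ => ?_
  unfold digitPhase
  rw [norm_div, Complex.norm_two]
  split_ifs with hj
  · rw [neg_one_mul, ← sub_eq_add_neg, norm_one_sub_eChar, mul_div_cancel_left₀ _ two_ne_zero]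
    rw [mul_add, show π * (1 / 2 : ℝ) = π / 2 by ring, add_comm, Real.cos_add_pi_div_two, abs_neg]
    ring_nf
  · rw [one_mul, norm_one_add_eChar, mul_div_cancel_left₀ _ two_ne_zero, zero_add]
    ring_nf

/-- `|ŵ_A(θ)| ≤ 1`. [folklore] -/
theorem norm_walshCoeff_le_one {n : ℕ} (A : Finset (Fin n)) (θ : ℝ) : ‖walshCoeff A θ‖ ≤ 1 := by
  rw [norm_walshCoeff_eq_prod]
  exact Finset.prod_le_one (fun j _ => abs_nonneg _) fun j _ => Real.abs_cos_le_one _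

/-! ### The pointwise inequality behind Lemma 3 -/

/-- `|sin x| + |cos x| ≤ √2`. [folklore] -/
theorem abs_sin_add_abs_cos_le_sqrt_two (x : ℝ) : |Real.sin x| + |Real.cos x| ≤ Real.sqrt 2 := by
  have h1 : (|Real.sin x| + |Real.cos x|) ^ 2 ≤ 2 := by
    have hsq : (|Real.sin x| + |Real.cos x|) ^ 2 = 1 + |Real.sin (2 * x)| := by
      rw [add_sq, sq_abs, sq_abs, Real.sin_two_mul, abs_mul, abs_mul, abs_two]
      nlinarith [Real.sin_sq_add_cos_sq x]
    rw [hsq]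
    linarith [Real.abs_sin_le_one (2 * x)]
  have h2 := Real.abs_le_sqrt h1
  rwa [abs_of_nonneg (by positivity)] at h2

/-- **Key inequality** (Bourgain 2013, (1.6) and the display after it): for all real `φ, ψ`,
`(|cos φ| + |sin φ|)|cos ψ| + (|cos(φ + π/4)| + |sin(φ + π/4)|)|sin ψ| ≤ √(2 + √2)`.
(By Cauchy–Schwarz the left side is at most `√(X² + Y²)` with `X² = 1 + |sin 2φ|`,
`Y² = 1 + |cos 2φ|`, and `|sin 2φ| + |cos 2φ| ≤ √2`.) [cite: Bourgain2013MoebiusWalsh, (1.6)] -/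
theorem key_inequality (φ ψ : ℝ) :
    (|Real.cos φ| + |Real.sin φ|) * |Real.cos ψ| +
        (|Real.cos (φ + π / 4)| + |Real.sin (φ + π / 4)|) * |Real.sin ψ| ≤
      Real.sqrt (2 + Real.sqrt 2) := by
  set X := |Real.cos φ| + |Real.sin φ| with hX
  set Y := |Real.cos (φ + π / 4)| + |Real.sin (φ + π / 4)| with hY
  set c := |Real.cos ψ| with hc
  set s := |Real.sin ψ| with hs
  have hcs : c ^ 2 + s ^ 2 = 1 := by rw [hc, hs, sq_abs, sq_abs, Real.cos_sq_add_sin_sq]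
  have hX2 : X ^ 2 = 1 + |Real.sin (2 * φ)| := by
    rw [hX, add_sq, sq_abs, sq_abs, Real.sin_two_mul, abs_mul, abs_mul, abs_two]
    nlinarith [Real.sin_sq_add_cos_sq φ]
  have hY2 : Y ^ 2 = 1 + |Real.cos (2 * φ)| := by
    rw [hY, add_sq, sq_abs, sq_abs]
    have h1 : Real.sin (2 * (φ + π / 4)) = Real.cos (2 * φ) := by
      rw [show 2 * (φ + π / 4) = 2 * φ + π / 2 by ring, Real.sin_add_pi_div_two]
    have h2 : 2 * |Real.cos (φ + π / 4)| * |Real.sin (φ + π / 4)| = |Real.cos (2 * φ)| := by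
      rw [← h1, Real.sin_two_mul, abs_mul, abs_mul, abs_two]; ring
    nlinarith [Real.sin_sq_add_cos_sq (φ + π / 4)]
  have hXY : X ^ 2 + Y ^ 2 ≤ 2 + Real.sqrt 2 := by
    rw [hX2, hY2]
    linarith [abs_sin_add_abs_cos_le_sqrt_two (2 * φ)]
  have hX0 : 0 ≤ X := by positivity
  have hY0 : 0 ≤ Y := by positivity
  have hc0 : 0 ≤ c := abs_nonneg _
  have hs0 : 0 ≤ s := abs_nonneg _
  have hmain : (X * c + Y * s) ^ 2 ≤ 2 + Real.sqrt 2 := by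
    calc (X * c + Y * s) ^ 2 ≤ (X ^ 2 + Y ^ 2) * (c ^ 2 + s ^ 2) := by
          nlinarith [sq_nonneg (X * s - Y * c)]
      _ = X ^ 2 + Y ^ 2 := by rw [hcs, mul_one]
      _ ≤ 2 + Real.sqrt 2 := hXY
  have h := Real.abs_le_sqrt hmain
  rwa [abs_of_nonneg (by positivity)] at h

/-! ### Cosine products along the doubling map and their sums (Lemma 3, abstract form) -/

/-- `P_n(u; t) = ∏_{j < n} |cos π(u_j + 2^j t)|` for a phase sequence `u`. [folklore] -/
def cosProd (u : ℕ → ℝ) (n : ℕ) (t : ℝ) : ℝ :=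
  ∏ j ∈ range n, |Real.cos (π * (u j + 2 ^ j * t))|

/-- `S_n(u) = ∑_{k < 2^n} P_n(u; k/2^n)`. [folklore] -/
def cosProdSum (u : ℕ → ℝ) (n : ℕ) : ℝ :=
  ∑ k ∈ range (2 ^ n), cosProd u n ((k : ℝ) / 2 ^ n)

/-- `0 ≤ P_n(u; t)`. [folklore] -/
theorem cosProd_nonneg (u : ℕ → ℝ) (n : ℕ) (t : ℝ) : 0 ≤ cosProd u n t :=
  Finset.prod_nonneg fun _ _ => abs_nonneg _

/-- `P_n(u; t) ≤ 1`. [folklore] -/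
theorem cosProd_le_one (u : ℕ → ℝ) (n : ℕ) (t : ℝ) : cosProd u n t ≤ 1 :=
  Finset.prod_le_one (fun _ _ => abs_nonneg _) fun _ _ => Real.abs_cos_le_one _

/-- `0 ≤ S_n(u)`. [folklore] -/
theorem cosProdSum_nonneg (u : ℕ → ℝ) (n : ℕ) : 0 ≤ cosProdSum u n :=
  Finset.sum_nonneg fun _ _ => cosProd_nonneg _ _ _

/-- `S_0 = 1`. [folklore] -/
theorem cosProdSum_zero (u : ℕ → ℝ) : cosProdSum u 0 = 1 := by
  simp [cosProdSum, cosProd]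

/-- `S_1 ≤ 2`. [folklore] -/
theorem cosProdSum_one_le (u : ℕ → ℝ) : cosProdSum u 1 ≤ 2 := by
  unfold cosProdSum
  calc ∑ k ∈ range (2 ^ 1), cosProd u 1 (k / 2 ^ 1) ≤ ∑ _k ∈ range (2 ^ 1), (1 : ℝ) :=
        Finset.sum_le_sum fun k _ => cosProd_le_one _ _ _
    _ = 2 := by simp

/-- Splitting a sum over `range (a * b)` into `b` blocks of length `a`. [folklore] -/
theorem sum_range_mul_eq_sum_sum (f : ℕ → ℝ) (a b : ℕ) :
    ∑ k ∈ range (a * b), f k = ∑ m ∈ range b, ∑ k ∈ range a, f (k + a * m) := by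
  induction b with
  | zero => simp
  | succ b ih =>
    rw [Nat.mul_succ, Finset.sum_range_add, ih, Finset.sum_range_succ]
    congr 1
    exact Finset.sum_congr rfl fun k _ => by rw [add_comm]

/-- `|cos (x + m π)| = |cos x|` for a natural number `m`. [folklore] -/
theorem abs_cos_add_nat_mul_pi (x : ℝ) (m : ℕ) : |Real.cos (x + m * π)| = |Real.cos x| := by
  rw [Real.cos_add_nat_mul_pi, abs_mul, abs_pow, abs_neg, abs_one, one_pow, one_mul]

/-- The tail factors after the shift `k = k' + 2ⁿ m`: for `j ≥ 2` the phase moves by an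
integer multiple of `π`. [folklore] -/
theorem cosProd_shift_tail (u : ℕ → ℝ) (n k m : ℕ) :
    ∏ j ∈ range n, |Real.cos (π * (u (j + 2) + 2 ^ (j + 2) * (((k + 2 ^ n * m : ℕ) : ℝ) / 2 ^ (n + 2))))|
      = cosProd (fun j => u (j + 2)) n (k / 2 ^ n) := by
  unfold cosProd
  refine Finset.prod_congr rfl fun j _ => ?_
  have h2 : (2 : ℝ) ^ (n + 2) = 2 ^ n * 4 := by rw [pow_add]; norm_num
  have h2n : (2 : ℝ) ^ n ≠ 0 := pow_ne_zero _ two_ne_zero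
  have : π * (u (j + 2) + 2 ^ (j + 2) * (((k + 2 ^ n * m : ℕ) : ℝ) / 2 ^ (n + 2))) =
      π * (u (j + 2) + 2 ^ j * ((k : ℝ) / 2 ^ n)) + ((2 ^ j * m : ℕ) : ℝ) * π := by
    push_cast
    rw [h2]
    field_simp
    ring
  rw [this, abs_cos_add_nat_mul_pi]

/-- The two head factors after the shift `k = k' + 2ⁿ m`, summed over `m < 4`, are bounded by
`√(2 + √2)` (Bourgain 2013, (1.6)). [cite: Bourgain2013MoebiusWalsh, (1.6)] -/
theorem sum_head_le (u : ℕ → ℝ) (n k : ℕ) :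
    ∑ m ∈ range 4,
        |Real.cos (π * (u 0 + 2 ^ 0 * (((k + 2 ^ n * m : ℕ) : ℝ) / 2 ^ (n + 2))))| *
          |Real.cos (π * (u 1 + 2 ^ 1 * (((k + 2 ^ n * m : ℕ) : ℝ) / 2 ^ (n + 2))))| ≤
      Real.sqrt (2 + Real.sqrt 2) := by
  set φ := π * (u 0 + (k : ℝ) / 2 ^ (n + 2)) with hφ
  set ψ := π * (u 1 + 2 * ((k : ℝ) / 2 ^ (n + 2))) with hψ
  have h2 : (2 : ℝ) ^ (n + 2) = 2 ^ n * 4 := by rw [pow_add]; norm_num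
  have h2n : (2 : ℝ) ^ n ≠ 0 := pow_ne_zero _ two_ne_zero
  have hA : ∀ m : ℕ, π * (u 0 + 2 ^ 0 * (((k + 2 ^ n * m : ℕ) : ℝ) / 2 ^ (n + 2))) =
      φ + m * (π / 4) := by
    intro m; rw [hφ]; push_cast; rw [h2]; field_simp; ring
  have hB : ∀ m : ℕ, π * (u 1 + 2 ^ 1 * (((k + 2 ^ n * m : ℕ) : ℝ) / 2 ^ (n + 2))) =
      ψ + m * (π / 2) := by
    intro m; rw [hψ]; push_cast; rw [h2]; field_simp; ring
  simp only [hA, hB, Finset.sum_range_succ, Finset.sum_range_zero, zero_add, Nat.cast_zero,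
    zero_mul, add_zero, Nat.cast_one, one_mul, Nat.cast_ofNat]
  have e1 : Real.cos (ψ + π / 2) = -Real.sin ψ := Real.cos_add_pi_div_two ψ
  have e2 : Real.cos (φ + 2 * (π / 4)) = -Real.sin φ := by
    rw [show 2 * (π / 4) = π / 2 by ring]; exact Real.cos_add_pi_div_two φ
  have e3 : Real.cos (ψ + 2 * (π / 2)) = -Real.cos ψ := by
    rw [show 2 * (π / 2) = π by ring]; exact Real.cos_add_pi ψ
  have e4 : Real.cos (φ + 3 * (π / 4)) = -Real.sin (φ + π / 4) := by
    rw [show φ + 3 * (π / 4) = (φ + π / 4) + π / 2 by ring]; exact Real.cos_add_pi_div_two _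
  have e5 : Real.cos (ψ + 3 * (π / 2)) = Real.sin ψ := by
    rw [show ψ + 3 * (π / 2) = (ψ + π) + π / 2 by ring, Real.cos_add_pi_div_two, Real.sin_add_pi,
      neg_neg]
  rw [e1, e2, e3, e4, e5, abs_neg, abs_neg, abs_neg, abs_neg]
  have := key_inequality φ ψ
  nlinarith [this]

/-- **The two-step recursion** (Bourgain 2013, proof of Lemma 3: "Perform a shift
`k → k + c2^{λ-2} + d2^{λ-1}` … `≤ ¼√(2+√2)` … Iterating"): `S_{n+2}(u) ≤ √(2+√2) · S_n(u(· + 2))`.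
[cite: Bourgain2013MoebiusWalsh, Lemma 3 (proof)] -/
theorem cosProdSum_add_two_le (u : ℕ → ℝ) (n : ℕ) :
    cosProdSum u (n + 2) ≤ Real.sqrt (2 + Real.sqrt 2) * cosProdSum (fun j => u (j + 2)) n := by
  unfold cosProdSum
  rw [show 2 ^ (n + 2) = 2 ^ n * 4 by rw [pow_add]; norm_num, sum_range_mul_eq_sum_sum,
    Finset.sum_comm, Finset.mul_sum]
  refine Finset.sum_le_sum fun k _ => ?_
  have hsplit : ∀ m : ℕ, cosProd u (n + 2) (((k + 2 ^ n * m : ℕ) : ℝ) / 2 ^ (n + 2)) =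
      (|Real.cos (π * (u 0 + 2 ^ 0 * (((k + 2 ^ n * m : ℕ) : ℝ) / 2 ^ (n + 2))))| *
        |Real.cos (π * (u 1 + 2 ^ 1 * (((k + 2 ^ n * m : ℕ) : ℝ) / 2 ^ (n + 2))))|) *
        cosProd (fun j => u (j + 2)) n (k / 2 ^ n) := by
    intro m
    rw [← cosProd_shift_tail u n k m]
    unfold cosProd
    rw [Finset.prod_range_succ', Finset.prod_range_succ']
    ring
  rw [Finset.sum_congr rfl fun m _ => hsplit m, ← Finset.sum_mul]
  exact mul_le_mul_of_nonneg_right (sum_head_le u n k) (cosProd_nonneg _ _ _)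

/-- **Iterated recursion**: `S_n(u) ≤ 2 (√(2+√2))^{⌊n/2⌋}` for every phase sequence `u`
(no hypothesis on `u`). [cite: Bourgain2013MoebiusWalsh, Lemma 3 (proof)] -/
theorem cosProdSum_le_two_mul_pow : ∀ (n : ℕ) (u : ℕ → ℝ),
    cosProdSum u n ≤ 2 * Real.sqrt (2 + Real.sqrt 2) ^ (n / 2) := by
  intro n
  induction n using Nat.twoStepInduction with
  | zero => intro u; rw [cosProdSum_zero]; norm_num
  | one => intro u; simpa using cosProdSum_one_le u
  | more n ih0 _ =>
    intro u
    calc cosProdSum u (n + 2)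
        ≤ Real.sqrt (2 + Real.sqrt 2) * cosProdSum (fun j => u (j + 2)) n := cosProdSum_add_two_le u n
      _ ≤ Real.sqrt (2 + Real.sqrt 2) * (2 * Real.sqrt (2 + Real.sqrt 2) ^ (n / 2)) :=
          mul_le_mul_of_nonneg_left (ih0 _) (Real.sqrt_nonneg _)
      _ = 2 * Real.sqrt (2 + Real.sqrt 2) ^ ((n + 2) / 2) := by
          rw [Nat.add_div_right n two_pos, pow_succ]; ring

/-- The exponent `κ = log₂(2 + √2)/4 ≈ 0.4429 < 1/2` of the `ℓ¹` bound `‖ŵ_A‖₁ ≲ 2^{κ n}`.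
[cite: Bourgain2013MoebiusWalsh, Lemma 3] -/
def walshL1Exponent : ℝ := Real.logb 2 (2 + Real.sqrt 2) / 4

/-- `κ < 1/2` (i.e. `2 + √2 < 4`). [folklore] -/
theorem walshL1Exponent_lt_half : walshL1Exponent < 1 / 2 := by
  unfold walshL1Exponent
  have hs : Real.sqrt 2 < 2 := by
    rw [show (2 : ℝ) = Real.sqrt 4 by
      rw [show (4 : ℝ) = 2 ^ 2 by norm_num, Real.sqrt_sq (by norm_num : (0 : ℝ) ≤ 2)]]
    exact Real.sqrt_lt_sqrt (by norm_num) (by norm_num)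
  have h4 : Real.logb 2 (2 + Real.sqrt 2) < Real.logb 2 4 :=
    (Real.logb_lt_logb_iff one_lt_two (by positivity) (by norm_num)).2 (by linarith)
  have h44 : Real.logb 2 4 = 2 := by
    rw [show (4 : ℝ) = 2 ^ (2 : ℕ) by norm_num, Real.logb_pow, Real.logb_self_eq_one one_lt_two]
    norm_num
  linarith

/-- `0 < κ`. [folklore] -/
theorem walshL1Exponent_pos : 0 < walshL1Exponent := by
  unfold walshL1Exponent
  have : 0 < Real.logb 2 (2 + Real.sqrt 2) := Real.logb_pos one_lt_two (by
    have := Real.sqrt_nonneg 2; linarith)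
  positivity

/-- `2^{κ n} = (2 + √2)^{n/4}`. [folklore] -/
theorem two_rpow_walshL1Exponent_mul (n : ℕ) :
    (2 : ℝ) ^ (walshL1Exponent * n) = (2 + Real.sqrt 2) ^ ((n : ℝ) / 4) := by
  unfold walshL1Exponent
  rw [show Real.logb 2 (2 + Real.sqrt 2) / 4 * n = Real.logb 2 (2 + Real.sqrt 2) * ((n : ℝ) / 4) by
    ring, Real.rpow_mul (by norm_num : (0 : ℝ) ≤ 2),
    Real.rpow_logb two_pos (by norm_num) (by positivity)]

/-- `S_n(u) ≤ 2 · 2^{κ n}` in real-exponent form. [cite: Bourgain2013MoebiusWalsh, Lemma 3 (proof)] -/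
theorem cosProdSum_le_rpow (u : ℕ → ℝ) (n : ℕ) :
    cosProdSum u n ≤ 2 * (2 : ℝ) ^ (walshL1Exponent * n) := by
  refine (cosProdSum_le_two_mul_pow n u).trans ?_
  rw [two_rpow_walshL1Exponent_mul]
  refine mul_le_mul_of_nonneg_left ?_ zero_le_two
  have hB : (1 : ℝ) ≤ 2 + Real.sqrt 2 := by have := Real.sqrt_nonneg 2; linarith
  have hB0 : (0 : ℝ) ≤ 2 + Real.sqrt 2 := by linarith
  rw [Real.sqrt_eq_rpow, ← Real.rpow_natCast, ← Real.rpow_mul hB0]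
  refine Real.rpow_le_rpow_of_exponent_le hB ?_
  have h := Nat.cast_div_le (m := n) (n := 2) (α := ℝ)
  push_cast at h
  linarith

/-- The digit phases of `A` as a sequence on `ℕ` (extended by `0`). [folklore] -/
def digitPhaseSeq {n : ℕ} (A : Finset (Fin n)) : ℕ → ℝ :=
  fun j => if h : j < n then digitPhase A ⟨j, h⟩ else 0

/-- `|ŵ_A(θ)| = P_n(u_A; θ)`. [cite: Bourgain2013MoebiusWalsh, (1.5)] -/
theorem norm_walshCoeff_eq_cosProd {n : ℕ} (A : Finset (Fin n)) (θ : ℝ) :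
    ‖walshCoeff A θ‖ = cosProd (digitPhaseSeq A) n θ := by
  rw [norm_walshCoeff_eq_prod, cosProd,
    ← Fin.prod_univ_eq_prod_range (fun j => |Real.cos (π * (digitPhaseSeq A j + 2 ^ j * θ))|) n]
  refine Finset.prod_congr rfl fun j _ => ?_
  simp [digitPhaseSeq, j.isLt]

/-- **Bourgain 2013, Lemma 3** (the `ℓ¹` estimate of Mauduit–Rivat type), explicit form:
`∑_{k < 2ⁿ} |ŵ_A(k/2ⁿ)| ≤ 2 · 2^{κ n}` with `κ = log₂(2+√2)/4 < 1/2`, uniformly in `A`.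
[cite: Bourgain2013MoebiusWalsh, Lemma 3 (1.4)] -/
theorem sum_norm_walshCoeff_le {n : ℕ} (A : Finset (Fin n)) :
    ∑ k ∈ range (2 ^ n), ‖walshCoeff A ((k : ℝ) / 2 ^ n)‖ ≤ 2 * (2 : ℝ) ^ (walshL1Exponent * n) := by
  have : ∑ k ∈ range (2 ^ n), ‖walshCoeff A ((k : ℝ) / 2 ^ n)‖ = cosProdSum (digitPhaseSeq A) n := by
    unfold cosProdSum
    exact Finset.sum_congr rfl fun k _ => norm_walshCoeff_eq_cosProd A _
  rw [this]
  exact cosProdSum_le_rpow _ _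

/-- **Bourgain 2013, Lemma 3, as printed**: "`∑_{k < 2^λ} |ŵ_A(k)| ≲ 2^{(1/2 - c)λ}` for some
constant `c > 0`" (uniformly in `λ` and `A ⊆ {0, …, λ-1}`); here with the implied constant `2` and
`c = 1/2 - log₂(2+√2)/4 ≈ 0.057`. [cite: Bourgain2013MoebiusWalsh, Lemma 3 (1.4)] -/
theorem bourgain2013_lemma3 : ∃ c : ℝ, 0 < c ∧ ∀ (n : ℕ) (A : Finset (Fin n)),
    ∑ k ∈ range (2 ^ n), ‖walshCoeff A ((k : ℝ) / 2 ^ n)‖ ≤ 2 * (2 : ℝ) ^ ((1 / 2 - c) * n) := by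
  refine ⟨1 / 2 - walshL1Exponent, sub_pos.2 walshL1Exponent_lt_half, fun n A => ?_⟩
  rw [show 1 / 2 - (1 / 2 - walshL1Exponent) = walshL1Exponent by ring]
  exact sum_norm_walshCoeff_le A

/-! ### The sup-norm bound (Lemma 2) -/

/-- `4 z² (1 - z) ≤ 16/27` on `[0, 1]` (AM–GM; equality at `z = 2/3`). [folklore] -/
theorem four_mul_sq_mul_one_sub_le {z : ℝ} (h0 : 0 ≤ z) : 4 * (z ^ 2 * (1 - z)) ≤ 16 / 27 := by
  nlinarith [mul_nonneg (sq_nonneg (z - 2 / 3)) (by linarith : (0 : ℝ) ≤ z + 1 / 3)]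

/-- `(|cos y| |sin 2y|)² ≤ 16/27`. [cite: Bourgain2013MoebiusWalsh, Lemma 2 (proof)] -/
theorem sq_abs_cos_mul_abs_sin_two_mul_le (y : ℝ) :
    (|Real.cos y| * |Real.sin (2 * y)|) ^ 2 ≤ 16 / 27 := by
  rw [mul_pow, sq_abs, sq_abs, Real.sin_two_mul]
  calc Real.cos y ^ 2 * (2 * Real.sin y * Real.cos y) ^ 2
      = 4 * ((Real.cos y ^ 2) ^ 2 * (1 - Real.cos y ^ 2)) := by rw [← Real.sin_sq]; ring
    _ ≤ 16 / 27 := four_mul_sq_mul_one_sub_le (sq_nonneg _)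

/-- `(|sin y| |sin 2y|)² ≤ 16/27`. [cite: Bourgain2013MoebiusWalsh, Lemma 2 (proof)] -/
theorem sq_abs_sin_mul_abs_sin_two_mul_le (y : ℝ) :
    (|Real.sin y| * |Real.sin (2 * y)|) ^ 2 ≤ 16 / 27 := by
  rw [mul_pow, sq_abs, sq_abs, Real.sin_two_mul]
  calc Real.sin y ^ 2 * (2 * Real.sin y * Real.cos y) ^ 2
      = 4 * ((Real.sin y ^ 2) ^ 2 * (1 - Real.sin y ^ 2)) := by rw [← Real.cos_sq']; ring
    _ ≤ 16 / 27 := four_mul_sq_mul_one_sub_le (sq_nonneg _)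

/-- Dropping factors in `[0, 1]`: `∏_univ f ≤ ∏_s f`. [folklore] -/
theorem prod_univ_le_prod_of_le_one {ι : Type*} [Fintype ι] [DecidableEq ι] (s : Finset ι)
    {f : ι → ℝ} (h0 : ∀ i, 0 ≤ f i) (h1 : ∀ i, f i ≤ 1) : ∏ i, f i ≤ ∏ i ∈ s, f i := by
  rw [← Finset.prod_mul_prod_compl s f]
  exact mul_le_of_le_one_right (Finset.prod_nonneg fun i _ => h0 i)
    (Finset.prod_le_one (fun i _ => h0 i) fun i _ => h1 i)

/-- **Bourgain 2013, Lemma 2**, explicit form: `|ŵ_A(θ)|⁴ ≤ (16/27)^{|A| - 1}` for every real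
`θ`. (Each `i ∈ A` with `i ≥ 1` pairs with `i - 1`: if `|sin π 2^i θ| ≈ 1` then
`|cos π 2^{i-1} θ|, |sin π 2^{i-1} θ| ≈ 1/√2`; precisely the product of the two factors has square
`≤ 16/27`, and every index lies in at most two pairs.) [cite: Bourgain2013MoebiusWalsh, Lemma 2 (1.3)] -/
theorem norm_walshCoeff_pow_four_le {n : ℕ} (A : Finset (Fin n)) (θ : ℝ) :
    ‖walshCoeff A θ‖ ^ 4 ≤ (16 / 27 : ℝ) ^ (A.card - 1) := by
  classical
  rw [norm_walshCoeff_eq_prod]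
  set c : Fin n → ℝ := fun j => |Real.cos (π * (digitPhase A j + 2 ^ (j : ℕ) * θ))| with hc
  have hc0 : ∀ j, 0 ≤ c j := fun j => abs_nonneg _
  have hc1 : ∀ j, c j ≤ 1 := fun j => Real.abs_cos_le_one _
  set B : Finset (Fin n) := A.filter (fun j => 1 ≤ (j : ℕ)) with hB
  set pred : Fin n → Fin n := fun j => ⟨(j : ℕ) - 1, lt_of_le_of_lt (Nat.sub_le _ _) j.isLt⟩
    with hpred
  -- the pair bound
  have hpair : ∀ j ∈ B, (c (pred j) * c j) ^ 2 ≤ 16 / 27 := by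
    intro j hj
    rw [hB, Finset.mem_filter] at hj
    obtain ⟨hjA, hj1⟩ := hj
    have hjval : (j : ℕ) = ((pred j : Fin n) : ℕ) + 1 := by rw [hpred]; dsimp only; omega
    set y := π * (2 ^ ((pred j : Fin n) : ℕ) * θ) with hy
    have hcj : c j = |Real.sin (2 * y)| := by
      rw [hc]
      dsimp only
      rw [digitPhase, if_pos hjA, hjval, pow_succ, mul_add, show π * (1 / 2 : ℝ) = π / 2 by ring,
        add_comm, Real.cos_add_pi_div_two, abs_neg, hy]
      congr 2; ring
    have hcp : c (pred j) = |Real.cos y| ∨ c (pred j) = |Real.sin y| := by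
      rw [hc]
      dsimp only
      rw [digitPhase]
      split_ifs with hp
      · right
        rw [mul_add, show π * (1 / 2 : ℝ) = π / 2 by ring, add_comm, Real.cos_add_pi_div_two,
          abs_neg]
      · left
        rw [zero_add]
    rcases hcp with h | h
    · rw [h, hcj]; exact sq_abs_cos_mul_abs_sin_two_mul_le y
    · rw [h, hcj]; exact sq_abs_sin_mul_abs_sin_two_mul_le y
  -- every index is used at most twice
  have hP1 : ∏ j, c j ≤ ∏ j ∈ B, c j := prod_univ_le_prod_of_le_one B hc0 hc1
  have hinj : ∀ j ∈ B, ∀ j' ∈ B, pred j = pred j' → j = j' := by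
    intro j hj j' hj' h
    rw [hB, Finset.mem_filter] at hj hj'
    have hv := congrArg Fin.val h
    rw [hpred] at hv
    dsimp only at hv
    exact Fin.ext (by omega)
  have hP2 : ∏ j, c j ≤ ∏ j ∈ B, c (pred j) := by
    rw [← Finset.prod_image hinj]
    exact prod_univ_le_prod_of_le_one _ hc0 hc1
  have hP0 : 0 ≤ ∏ j, c j := Finset.prod_nonneg fun j _ => hc0 j
  have hcard : A.card - 1 ≤ B.card := by
    have hsum := Finset.card_filter_add_card_filter_not (s := A) (fun j : Fin n => 1 ≤ (j : ℕ))
    have hle : (A.filter (fun j : Fin n => ¬ 1 ≤ (j : ℕ))).card ≤ 1 := by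
      refine Finset.card_le_one.2 fun a ha b hb => ?_
      rw [Finset.mem_filter] at ha hb
      exact Fin.ext (by omega)
    rw [hB]
    omega
  calc (∏ j, c j) ^ 4 = ((∏ j, c j) * ∏ j, c j) ^ 2 := by ring
    _ ≤ ((∏ j ∈ B, c (pred j)) * ∏ j ∈ B, c j) ^ 2 :=
        pow_le_pow_left₀ (mul_nonneg hP0 hP0)
          (mul_le_mul hP2 hP1 hP0 (Finset.prod_nonneg fun j _ => hc0 _)) 2
    _ = ∏ j ∈ B, (c (pred j) * c j) ^ 2 := by rw [← Finset.prod_mul_distrib, ← Finset.prod_pow]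
    _ ≤ ∏ _j ∈ B, (16 / 27 : ℝ) := Finset.prod_le_prod (fun j _ => sq_nonneg _) hpair
    _ = (16 / 27 : ℝ) ^ B.card := Finset.prod_const _
    _ ≤ (16 / 27 : ℝ) ^ (A.card - 1) := pow_le_pow_of_le_one (by norm_num) (by norm_num) hcard

/-- The exponent `c₂ = log₂(27/16)/4 ≈ 0.189` of the sup-norm bound `‖ŵ_A‖_∞ ≲ 2^{-c₂|A|}`.
[cite: Bourgain2013MoebiusWalsh, Lemma 2] -/
def walshSupExponent : ℝ := Real.logb 2 (27 / 16) / 4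

/-- `0 < c₂`. [folklore] -/
theorem walshSupExponent_pos : 0 < walshSupExponent := by
  unfold walshSupExponent
  have : 0 < Real.logb 2 (27 / 16) := Real.logb_pos one_lt_two (by norm_num)
  positivity

/-- `2^{-4c₂} = 16/27`. [folklore] -/
theorem two_rpow_neg_four_mul_walshSupExponent :
    (2 : ℝ) ^ (-(4 * walshSupExponent)) = 16 / 27 := by
  unfold walshSupExponent
  rw [show 4 * (Real.logb 2 (27 / 16) / 4) = Real.logb 2 (27 / 16) by ring,
    Real.rpow_neg (by norm_num : (0 : ℝ) ≤ 2), Real.rpow_logb two_pos (by norm_num) (by norm_num)]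
  norm_num

/-- **Bourgain 2013, Lemma 2, as printed**: "`‖ŵ_A‖_∞ ≲ 2^{-c|A|}` for some constant `c > 0`";
here for every real frequency `θ` (in particular `θ = k/2ⁿ`), with implied constant `2` and
`c = log₂(27/16)/4`. [cite: Bourgain2013MoebiusWalsh, Lemma 2 (1.3)] -/
theorem bourgain2013_lemma2 : ∃ c : ℝ, 0 < c ∧ ∀ (n : ℕ) (A : Finset (Fin n)) (θ : ℝ),
    ‖walshCoeff A θ‖ ≤ 2 * (2 : ℝ) ^ (-(c * A.card)) := by
  refine ⟨walshSupExponent, walshSupExponent_pos, fun n A θ => ?_⟩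
  set P := ‖walshCoeff A θ‖ with hP
  set Q : ℝ := (2 : ℝ) ^ (-(walshSupExponent * A.card)) with hQ
  have hP0 : 0 ≤ P := norm_nonneg _
  have hQ0 : 0 < Q := Real.rpow_pos_of_pos two_pos _
  have hQ4 : Q ^ 4 = (16 / 27 : ℝ) ^ A.card := by
    rw [hQ, ← Real.rpow_natCast, ← Real.rpow_mul (by norm_num : (0 : ℝ) ≤ 2),
      show -(walshSupExponent * A.card) * ((4 : ℕ) : ℝ) = -(4 * walshSupExponent) * A.card by
        push_cast; ring,
      Real.rpow_mul (by norm_num : (0 : ℝ) ≤ 2), two_rpow_neg_four_mul_walshSupExponent,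
      Real.rpow_natCast]
  have h4 : P ^ 4 ≤ (2 * Q) ^ 4 := by
    calc P ^ 4 ≤ (16 / 27 : ℝ) ^ (A.card - 1) := norm_walshCoeff_pow_four_le A θ
      _ ≤ 16 * (16 / 27 : ℝ) ^ A.card := by
          rcases Nat.eq_zero_or_pos A.card with h0 | hpos
          · rw [h0]; norm_num
          · obtain ⟨m, hm⟩ := Nat.exists_eq_add_of_le hpos
            rw [hm, Nat.add_sub_cancel_left, pow_add, pow_one]
            have : 0 ≤ (16 / 27 : ℝ) ^ m := by positivity
            nlinarith [this]
      _ = (2 * Q) ^ 4 := by rw [mul_pow, hQ4]; norm_num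
  exact (pow_le_pow_iff_left₀ hP0 (by positivity) (by norm_num)).1 h4

/-! ### Fourier inversion on `ℤ/2ⁿℤ` (Lemma 1, first half) -/

/-- The digit vector is determined by its value: `x ↦ val x` is injective. [folklore] -/
theorem bitsToNat_ofFn_injective (n : ℕ) :
    Function.Injective (fun x : Fin n → Bool => bitsToNat (List.ofFn x)) := by
  induction n with
  | zero => intro x y _; exact funext fun i => i.elim0
  | succ n ih =>
    intro x y h
    simp only [List.ofFn_succ, bitsToNat_cons] at h
    have h0 : (x 0).toNat = (y 0).toNat := by
      have := congrArg (· % 2) h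
      simp only [Nat.add_mul_mod_self_left] at this
      have hx : (x 0).toNat < 2 := Bool.toNat_lt _
      have hy : (y 0).toNat < 2 := Bool.toNat_lt _
      rwa [Nat.mod_eq_of_lt hx, Nat.mod_eq_of_lt hy] at this
    have hxy0 : x 0 = y 0 := by
      revert h0
      cases x 0 <;> cases y 0 <;> simp
    have htail : (fun i : Fin n => x i.succ) = fun i => y i.succ := by
      apply ih
      dsimp only
      omega
    funext i
    refine Fin.cases hxy0 (fun i => ?_) i
    exact congrFun htail i

/-- `val x < 2ⁿ`. [folklore] -/
theorem bitsToNat_ofFn_lt {n : ℕ} (x : Fin n → Bool) : bitsToNat (List.ofFn x) < 2 ^ n := by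
  simpa using bitsToNat_lt (List.ofFn x)

/-- `e(m t) = e(t)^m` for a natural number `m`. [folklore] -/
theorem eChar_nat_mul (m : ℕ) (t : ℝ) : eChar (m * t) = eChar t ^ m := by
  unfold eChar
  rw [← Complex.exp_nat_mul]
  congr 1; push_cast; ring

/-- `e(t) = 1` forces `t ∈ ℤ`. [folklore] -/
theorem eChar_eq_one_iff (t : ℝ) : eChar t = 1 ↔ ∃ m : ℤ, t = m := by
  constructor
  · intro h
    unfold eChar at h
    obtain ⟨m, hm⟩ := Complex.exp_eq_one_iff.1 h
    refine ⟨m, ?_⟩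
    have h1 : ((2 * π * t : ℝ) : ℂ) * Complex.I = ((2 * π * m : ℝ) : ℂ) * Complex.I := by
      rw [hm]; push_cast; ring
    have h2 := mul_right_cancel₀ Complex.I_ne_zero h1
    have h3 : 2 * π * t = 2 * π * m := by exact_mod_cast h2
    have hπ : (0 : ℝ) < 2 * π := by positivity
    exact mul_left_cancel₀ hπ.ne' h3
  · rintro ⟨m, rfl⟩
    exact eChar_intCast m

/-- **Orthogonality of additive characters on `ℤ/2ⁿℤ`**:
`∑_{k < 2ⁿ} e(k d/2ⁿ) = 2ⁿ · [2ⁿ ∣ d]`. [folklore] -/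
theorem sum_eChar_mul_div (n : ℕ) (d : ℤ) :
    ∑ k ∈ range (2 ^ n), eChar (k * ((d : ℝ) / 2 ^ n)) =
      if (2 ^ n : ℤ) ∣ d then ((2 ^ n : ℕ) : ℂ) else 0 := by
  simp_rw [eChar_nat_mul]
  split_ifs with hd
  · obtain ⟨m, rfl⟩ := hd
    have : eChar (((2 ^ n * m : ℤ) : ℝ) / 2 ^ n) = 1 := by
      rw [show ((2 ^ n * m : ℤ) : ℝ) / 2 ^ n = (m : ℝ) by push_cast; field_simp]
      exact eChar_intCast m
    rw [this]
    simp
  · have hne : eChar ((d : ℝ) / 2 ^ n) ≠ 1 := by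
      intro h
      obtain ⟨m, hm⟩ := (eChar_eq_one_iff _).1 h
      apply hd
      refine ⟨m, ?_⟩
      have h2 : (d : ℝ) = 2 ^ n * m := by
        field_simp at hm
        linarith
      exact_mod_cast h2
    rw [geom_sum_eq hne, ← eChar_nat_mul]
    have : eChar (((2 ^ n : ℕ) : ℝ) * ((d : ℝ) / 2 ^ n)) = 1 := by
      rw [show ((2 ^ n : ℕ) : ℝ) * ((d : ℝ) / 2 ^ n) = (d : ℝ) by push_cast; field_simp]
      exact eChar_intCast d
    rw [this, sub_self, zero_div]

/-- `2ⁿ ∣ val y - val x` iff `y = x` (both values lie in `[0, 2ⁿ)` and `val` is injective).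
[folklore] -/
theorem two_pow_dvd_sub_iff {n : ℕ} (x y : Fin n → Bool) :
    ((2 ^ n : ℤ) ∣ ((bitsToNat (List.ofFn y) : ℤ) - (bitsToNat (List.ofFn x) : ℤ))) ↔ y = x := by
  constructor
  · intro h
    have hlt : |((bitsToNat (List.ofFn y) : ℤ) - (bitsToNat (List.ofFn x) : ℤ))| < (2 ^ n : ℤ) := by
      have hy : ((bitsToNat (List.ofFn y) : ℕ) : ℤ) < ((2 ^ n : ℕ) : ℤ) := by
        exact_mod_cast bitsToNat_ofFn_lt y
      have hx : ((bitsToNat (List.ofFn x) : ℕ) : ℤ) < ((2 ^ n : ℕ) : ℤ) := by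
        exact_mod_cast bitsToNat_ofFn_lt x
      have h2 : ((2 : ℤ) ^ n) = ((2 ^ n : ℕ) : ℤ) := by norm_cast
      rw [h2, abs_lt]
      constructor <;> omega
    have h0 := Int.eq_zero_of_abs_lt_dvd h hlt
    apply bitsToNat_ofFn_injective n
    dsimp only
    omega
  · rintro rfl
    simp

/-- **Fourier inversion** (Bourgain 2013, Lemma 1, first assertion:
"`w_A(x) = ∑_{k < 2^λ} ŵ_A(k) e(kx/2^λ)`"; with our sign convention for `ŵ_A` the character on
the right is `e(-k · val x/2ⁿ)`). [cite: Bourgain2013MoebiusWalsh, Lemma 1] -/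
theorem walshSign_eq_sum_walshCoeff {n : ℕ} (A : Finset (Fin n)) (x : Fin n → Bool) :
    (walshSign A x : ℂ) = ∑ k ∈ range (2 ^ n),
      walshCoeff A ((k : ℝ) / 2 ^ n) * eChar (-(k * ((bitsToNat (List.ofFn x) : ℝ) / 2 ^ n))) := by
  classical
  unfold walshCoeff
  simp_rw [Finset.mul_sum, Finset.sum_mul]
  rw [Finset.sum_comm]
  have hval : ∀ y : Fin n → Bool,
      ∑ k ∈ range (2 ^ n), ((2 : ℂ) ^ n)⁻¹ * ((walshSign A y : ℂ) *
          eChar ((k : ℝ) / 2 ^ n * bitsToNat (List.ofFn y))) *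
        eChar (-(k * ((bitsToNat (List.ofFn x) : ℝ) / 2 ^ n))) =
      ((2 : ℂ) ^ n)⁻¹ * (walshSign A y : ℂ) *
        ∑ k ∈ range (2 ^ n), eChar (k * ((((bitsToNat (List.ofFn y) : ℤ) -
          (bitsToNat (List.ofFn x) : ℤ) : ℤ) : ℝ) / 2 ^ n)) := by
    intro y
    rw [Finset.mul_sum]
    refine Finset.sum_congr rfl fun k _ => ?_
    rw [mul_assoc, mul_assoc, ← eChar_add, mul_assoc]
    congr 3
    push_cast
    ring
  simp_rw [hval, sum_eChar_mul_div]
  simp_rw [two_pow_dvd_sub_iff x]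
  rw [Finset.sum_eq_single x (fun y _ hy => by rw [if_neg hy, mul_zero]) (fun h => absurd (mem_univ x) h),
    if_pos rfl]
  push_cast
  field_simp

/-! ### From digit vectors to `{0, …, 2ⁿ - 1}` and the `ℓ¹ × sup` bridge -/

/-- The digit vectors of length `n` enumerate `{0, …, 2ⁿ - 1}`: `∑_x F(val x) = ∑_{m < 2ⁿ} F(m)`.
[folklore] -/
theorem sum_digits_eq_sum_range {M : Type*} [AddCommMonoid M] (n : ℕ) (F : ℕ → M) :
    ∑ x : Fin n → Bool, F (bitsToNat (List.ofFn x)) = ∑ m ∈ range (2 ^ n), F m := by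
  classical
  have hinj : Set.InjOn (fun x : Fin n → Bool => bitsToNat (List.ofFn x)) ↑(Finset.univ : Finset (Fin n → Bool)) :=
    (bitsToNat_ofFn_injective n).injOn
  have himage : (Finset.univ : Finset (Fin n → Bool)).image
      (fun x : Fin n → Bool => bitsToNat (List.ofFn x)) = range (2 ^ n) := by
    apply Finset.eq_of_subset_of_card_le
    · intro m hm
      rw [Finset.mem_image] at hm
      obtain ⟨x, _, rfl⟩ := hm
      exact Finset.mem_range.2 (bitsToNat_ofFn_lt x)
    · rw [Finset.card_image_of_injOn hinj, Finset.card_univ, Fintype.card_fun, Fintype.card_bool,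
        Fintype.card_fin, Finset.card_range]
  rw [← himage, Finset.sum_image hinj]

/-- The exponential sum `G(θ) = ∑_{m < 2ⁿ} g(m) e(θ m)` of an arithmetic function over the dyadic
range (Bourgain 2013, §0: "estimates on the usual Fourier spectrum of `μ`"). [folklore] -/
def dyadicExpSum (n : ℕ) (g : ℕ → ℤ) (θ : ℝ) : ℂ :=
  ∑ m ∈ range (2 ^ n), (g m : ℂ) * eChar (θ * m)

/-- **Walsh sums through the Fourier–Walsh coefficients** (Bourgain 2013, §0, "by an expansion of
`w_A` in the trigonometric system"; §3, (3.2)): `∑_{x < 2ⁿ} g(x) w_A(x) = ∑_{k < 2ⁿ} ŵ_A(k/2ⁿ) G(-k/2ⁿ)`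
with `G(θ) = ∑_{m < 2ⁿ} g(m) e(θ m)`. [cite: Bourgain2013MoebiusWalsh, (3.2)] -/
theorem walshSum_eq_sum_walshCoeff_mul_dyadicExpSum {n : ℕ} (g : ℕ → ℤ) (A : Finset (Fin n)) :
    (walshSum g A : ℂ) = ∑ k ∈ range (2 ^ n),
      walshCoeff A ((k : ℝ) / 2 ^ n) * dyadicExpSum n g (-((k : ℝ) / 2 ^ n)) := by
  rw [walshSum_eq_sum_walshSign]
  push_cast
  simp_rw [walshSign_eq_sum_walshCoeff, Finset.mul_sum]
  rw [Finset.sum_comm]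
  refine Finset.sum_congr rfl fun k _ => ?_
  unfold dyadicExpSum
  rw [Finset.mul_sum, ← sum_digits_eq_sum_range n (fun m => walshCoeff A ((k : ℝ) / 2 ^ n) *
    ((g m : ℂ) * eChar (-((k : ℝ) / 2 ^ n) * m)))]
  refine Finset.sum_congr rfl fun x _ => ?_
  rw [show -((k : ℝ) / 2 ^ n) * (bitsToNat (List.ofFn x) : ℕ) =
    -((k : ℝ) * ((bitsToNat (List.ofFn x) : ℝ) / 2 ^ n)) by ring]
  ring

/-- **The `ℓ¹ × sup` bound** (Bourgain 2013, (3.12): "`|∑_{n<X} μ(n) w_S(n)| < ‖ŵ_S‖₁ · sup`"): if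
`|G(-k/2ⁿ)| ≤ M` for all `k < 2ⁿ` then `|∑_x g(x) w_A(x)| ≤ (∑_k |ŵ_A(k/2ⁿ)|) · M`.
[cite: Bourgain2013MoebiusWalsh, (3.12)] -/
theorem abs_walshSum_le_sum_norm_walshCoeff_mul {n : ℕ} (g : ℕ → ℤ) (A : Finset (Fin n)) {M : ℝ}
    (hM : ∀ k ∈ range (2 ^ n), ‖dyadicExpSum n g (-((k : ℝ) / 2 ^ n))‖ ≤ M) :
    |walshSum g A| ≤ (∑ k ∈ range (2 ^ n), ‖walshCoeff A ((k : ℝ) / 2 ^ n)‖) * M := by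
  have h : ‖(walshSum g A : ℂ)‖ ≤ (∑ k ∈ range (2 ^ n), ‖walshCoeff A ((k : ℝ) / 2 ^ n)‖) * M := by
    rw [walshSum_eq_sum_walshCoeff_mul_dyadicExpSum, Finset.sum_mul]
    refine (norm_sum_le _ _).trans (Finset.sum_le_sum fun k hk => ?_)
    rw [norm_mul]
    exact mul_le_mul_of_nonneg_left (hM k hk) (norm_nonneg _)
  rwa [Complex.norm_real, Real.norm_eq_abs] at h

/-- **Uniform Walsh bound from a uniform exponential-sum bound** (Bourgain 2013, (3.12) with
Lemma 3): if `|∑_{m < 2ⁿ} g(m) e(-km/2ⁿ)| ≤ M` for all `k < 2ⁿ`, then for EVERY `A ⊆ {0,…,n-1}`,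
`|∑_{x < 2ⁿ} g(x) w_A(x)| ≤ 2 · 2^{κ n} · M` with `κ = log₂(2+√2)/4 < 1/2`.
[cite: Bourgain2013MoebiusWalsh, (3.12) and Lemma 3] -/
theorem abs_walshSum_le_of_dyadicExpSum_le {n : ℕ} (g : ℕ → ℤ) (A : Finset (Fin n)) {M : ℝ}
    (hM : ∀ k ∈ range (2 ^ n), ‖dyadicExpSum n g (-((k : ℝ) / 2 ^ n))‖ ≤ M) :
    |walshSum g A| ≤ 2 * (2 : ℝ) ^ (walshL1Exponent * n) * M := by
  have hM0 : 0 ≤ M := (norm_nonneg _).trans (hM 0 (Finset.mem_range.2 (Nat.two_pow_pos n)))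
  exact (abs_walshSum_le_sum_norm_walshCoeff_mul g A hM).trans
    (mul_le_mul_of_nonneg_right (sum_norm_walshCoeff_le A) hM0)

/-! ### Sums over intervals (Lemma 6) -/

/-- `P_n(u; t + q) = P_n(u; t)` for a natural number `q` (period `1` in `t`). [folklore] -/
theorem cosProd_add_nat (u : ℕ → ℝ) (n : ℕ) (t : ℝ) (q : ℕ) :
    cosProd u n (t + q) = cosProd u n t := by
  unfold cosProd
  refine Finset.prod_congr rfl fun j _ => ?_
  rw [show π * (u j + 2 ^ j * (t + q)) = π * (u j + 2 ^ j * t) + ((2 ^ j * q : ℕ) : ℝ) * π by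
    push_cast; ring, abs_cos_add_nat_mul_pi]

/-- Keeping only the top `m` digit factors: `P_n(u; t) ≤ P_m(u(· + (n - m)); 2^{n-m} t)` for
`m ≤ n` (Bourgain 2013, proof of Lemma 6: "`|ŵ_A(k)| ≤ ∏_{λ-m ≤ i < λ} |cos π(u_i/2 + k/2^{λ-i})| =
|ŵ_{A₁}(k)|`"). [cite: Bourgain2013MoebiusWalsh, Lemma 6 (proof)] -/
theorem cosProd_le_cosProd_top (u : ℕ → ℝ) {m n : ℕ} (hmn : m ≤ n) (t : ℝ) :
    cosProd u n t ≤ cosProd (fun i => u (n - m + i)) m (2 ^ (n - m) * t) := by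
  have hsplit := Finset.prod_range_mul_prod_Ico
    (fun j => |Real.cos (π * (u j + 2 ^ j * t))|) (Nat.sub_le n m)
  have htop : ∏ j ∈ Ico (n - m) n, |Real.cos (π * (u j + 2 ^ j * t))| =
      cosProd (fun i => u (n - m + i)) m (2 ^ (n - m) * t) := by
    rw [Finset.prod_Ico_eq_prod_range, show n - (n - m) = m by omega]
    unfold cosProd
    refine Finset.prod_congr rfl fun i _ => ?_
    rw [pow_add]; ring_nf
  unfold cosProd at hsplit ⊢
  rw [← hsplit]
  unfold cosProd at htop
  rw [htop]
  exact mul_le_of_le_one_left (cosProd_nonneg _ _ _) (cosProd_le_one _ _ _)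

/-- Every window of length `P` of a `P`-periodic sequence has the same sum. [folklore] -/
theorem sum_Ico_eq_sum_range_of_periodic {M : Type*} [AddCommGroup M] {f : ℕ → M} {P : ℕ}
    (hper : ∀ k, f (k + P) = f k) (b : ℕ) :
    ∑ k ∈ Ico b (b + P), f k = ∑ k ∈ range P, f k := by
  induction b with
  | zero => rw [zero_add, Finset.range_eq_Ico]
  | succ b ih =>
    have h1 : ∑ k ∈ Ico b (b + P + 1), f k = (∑ k ∈ Ico b (b + P), f k) + f (b + P) :=
      Finset.sum_Ico_succ_top (Nat.le_add_right b P) f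
    rcases Nat.eq_zero_or_pos P with hP | hP
    · subst hP; simp
    have h2 : ∑ k ∈ Ico b (b + P + 1), f k = f b + ∑ k ∈ Ico (b + 1) (b + P + 1), f k :=
      Finset.sum_eq_sum_Ico_succ_bot (by omega) f
    rw [show b + 1 + P = b + P + 1 by ring, ← ih]
    rw [h1, hper b, add_comm] at h2
    exact (add_left_cancel h2).symm

/-- A shifted full period: `∑_{k < P} f (k + c) = ∑_{k < P} f k` for a `P`-periodic `f`. [folklore] -/
theorem sum_range_add_eq_of_periodic {M : Type*} [AddCommGroup M] {f : ℕ → M} {P : ℕ}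
    (hper : ∀ k, f (k + P) = f k) (c : ℕ) :
    ∑ k ∈ range P, f (k + c) = ∑ k ∈ range P, f k := by
  rw [← sum_Ico_eq_sum_range_of_periodic hper c]
  rw [Finset.sum_Ico_eq_sum_range, show c + P - c = P by omega]
  exact Finset.sum_congr rfl fun k _ => by rw [add_comm]

/-- A window of length `≤ P` of a nonnegative `P`-periodic sequence sums to at most one period.
[folklore] -/
theorem sum_Ico_le_sum_range_of_periodic {f : ℕ → ℝ} {P : ℕ} (hper : ∀ k, f (k + P) = f k)
    (hf : ∀ k, 0 ≤ f k) (a L : ℕ) (hL : L ≤ P) :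
    ∑ k ∈ Ico a (a + L), f k ≤ ∑ k ∈ range P, f k := by
  calc ∑ k ∈ Ico a (a + L), f k ≤ ∑ k ∈ Ico a (a + P), f k :=
        Finset.sum_le_sum_of_subset_of_nonneg (Finset.Ico_subset_Ico_right (by omega))
          fun k _ _ => hf k
    _ = ∑ k ∈ range P, f k := sum_Ico_eq_sum_range_of_periodic hper a

/-- **Bourgain 2013, Lemma 6**, dyadic form: for `m ≤ n` and any window `J = [a, a + L)` of length
`L ≤ 2^m`, `∑_{k ∈ J} |ŵ_A(k/2ⁿ)| ≤ 2 · 2^{κ m}` (drop the low `n - m` digit factors, use the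
`2^m`-periodicity of the rest and Lemma 3 with `n` replaced by `m`).
[cite: Bourgain2013MoebiusWalsh, Lemma 6 (1.24)] -/
theorem sum_Ico_norm_walshCoeff_le {n m : ℕ} (A : Finset (Fin n)) (hmn : m ≤ n) (a L : ℕ)
    (hL : L ≤ 2 ^ m) :
    ∑ k ∈ Ico a (a + L), ‖walshCoeff A ((k : ℝ) / 2 ^ n)‖ ≤ 2 * (2 : ℝ) ^ (walshL1Exponent * m) := by
  set v : ℕ → ℝ := fun i => digitPhaseSeq A (n - m + i) with hv
  set F : ℕ → ℝ := fun k => cosProd v m ((k : ℝ) / 2 ^ m) with hF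
  have hle : ∀ k : ℕ, ‖walshCoeff A ((k : ℝ) / 2 ^ n)‖ ≤ F k := by
    intro k
    rw [norm_walshCoeff_eq_cosProd, hF]
    dsimp only
    have h := cosProd_le_cosProd_top (digitPhaseSeq A) hmn ((k : ℝ) / 2 ^ n)
    rwa [show (2 : ℝ) ^ (n - m) * ((k : ℝ) / 2 ^ n) = (k : ℝ) / 2 ^ m by
      rw [show (2 : ℝ) ^ n = 2 ^ (n - m) * 2 ^ m by rw [← pow_add, Nat.sub_add_cancel hmn]]
      field_simp] at h
  have hper : ∀ k, F (k + 2 ^ m) = F k := by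
    intro k
    rw [hF]
    dsimp only
    rw [show (((k + 2 ^ m : ℕ) : ℝ) / 2 ^ m) = (k : ℝ) / 2 ^ m + ((1 : ℕ) : ℝ) by
      push_cast; field_simp, cosProd_add_nat]
  calc ∑ k ∈ Ico a (a + L), ‖walshCoeff A ((k : ℝ) / 2 ^ n)‖
      ≤ ∑ k ∈ Ico a (a + L), F k := Finset.sum_le_sum fun k _ => hle k
    _ ≤ ∑ k ∈ range (2 ^ m), F k :=
        sum_Ico_le_sum_range_of_periodic hper (fun k => cosProd_nonneg _ _ _) a L hL
    _ = cosProdSum v m := rfl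
    _ ≤ 2 * (2 : ℝ) ^ (walshL1Exponent * m) := cosProdSum_le_rpow v m

/-- **Bourgain 2013, Lemma 6, as printed**: "If `J ⊂ [1, 2^λ[` is an interval, there is a bound
`∑_{k ∈ J} |ŵ_A(k)| ≲ |J|^{1/2 - c}`" — here for every window `J = [a, a + L)` with `1 ≤ L ≤ 2ⁿ`,
`∑_{k ∈ J} |ŵ_A(k/2ⁿ)| ≤ 4 L^κ`, `κ = log₂(2+√2)/4 = 1/2 - c`. [cite: Bourgain2013MoebiusWalsh, Lemma 6 (1.24)] -/
theorem sum_Ico_norm_walshCoeff_le_rpow {n : ℕ} (A : Finset (Fin n)) (a L : ℕ) (hL1 : 1 ≤ L)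
    (hLn : L ≤ 2 ^ n) :
    ∑ k ∈ Ico a (a + L), ‖walshCoeff A ((k : ℝ) / 2 ^ n)‖ ≤ 4 * (L : ℝ) ^ walshL1Exponent := by
  -- `m = min (log₂ L + 1) n`: `L ≤ 2^m` and `2^m ≤ 2L`
  set m := min (Nat.log 2 L + 1) n with hm
  have hmn : m ≤ n := min_le_right _ _
  have hL2m : L ≤ 2 ^ m := by
    rcases min_choice (Nat.log 2 L + 1) n with h | h
    · rw [hm, h]; exact (Nat.lt_pow_succ_log_self one_lt_two L).le
    · rw [hm, h]; exact hLn
  have h2mL : 2 ^ m ≤ 2 * L := by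
    have h1 : 2 ^ (Nat.log 2 L + 1) ≤ 2 * L := by
      rw [pow_succ]
      have := Nat.pow_log_le_self 2 (by omega : L ≠ 0)
      omega
    exact (Nat.pow_le_pow_right two_pos (min_le_left _ _)).trans h1
  refine (sum_Ico_norm_walshCoeff_le A hmn a L hL2m).trans ?_
  have hκ0 : 0 ≤ walshL1Exponent := walshL1Exponent_pos.le
  have hκ1 : walshL1Exponent ≤ 1 := by linarith [walshL1Exponent_lt_half]
  have h2m : (2 : ℝ) ^ (walshL1Exponent * m) = ((2 ^ m : ℕ) : ℝ) ^ walshL1Exponent := by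
    push_cast
    rw [← Real.rpow_natCast, ← Real.rpow_mul (by norm_num : (0 : ℝ) ≤ 2), mul_comm]
  rw [h2m]
  have hL0 : (0 : ℝ) ≤ L := Nat.cast_nonneg _
  calc 2 * (((2 ^ m : ℕ) : ℝ)) ^ walshL1Exponent ≤ 2 * ((2 * L : ℕ) : ℝ) ^ walshL1Exponent := by
        refine mul_le_mul_of_nonneg_left (Real.rpow_le_rpow (Nat.cast_nonneg _) ?_ hκ0) zero_le_two
        exact_mod_cast h2mL
    _ = 2 * (2 : ℝ) ^ walshL1Exponent * (L : ℝ) ^ walshL1Exponent := by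
        push_cast
        rw [Real.mul_rpow zero_le_two hL0]; ring
    _ ≤ 2 * 2 * (L : ℝ) ^ walshL1Exponent := by
        refine mul_le_mul_of_nonneg_right (mul_le_mul_of_nonneg_left ?_ zero_le_two)
          (Real.rpow_nonneg hL0 _)
        calc (2 : ℝ) ^ walshL1Exponent ≤ (2 : ℝ) ^ (1 : ℝ) :=
              Real.rpow_le_rpow_of_exponent_le one_le_two hκ1
          _ = 2 := Real.rpow_one 2
    _ = 4 * (L : ℝ) ^ walshL1Exponent := by ring

/-! ### The DFT of a general function on the cube: convolution and `ℓ¹` submultiplicativity -/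

/-- `e(t + m) = e(t)` for a natural number `m`. [folklore] -/
theorem eChar_add_natCast (t : ℝ) (m : ℕ) : eChar (t + m) = eChar t := by
  have h := eChar_add_intCast t (m : ℤ)
  rwa [Int.cast_natCast] at h

/-- The normalised discrete Fourier transform of `F : {0,1}ⁿ → ℂ` through the values
`val x ∈ ℤ/2ⁿℤ`: `F̂(k) = 2⁻ⁿ ∑_x F(x) e(k · val x/2ⁿ)`. [folklore] -/
def cubeDFT {n : ℕ} (F : (Fin n → Bool) → ℂ) (k : ℕ) : ℂ :=
  ((2 : ℂ) ^ n)⁻¹ * ∑ x : Fin n → Bool, F x * eChar (k * ((bitsToNat (List.ofFn x) : ℝ) / 2 ^ n))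

/-- `ŵ_A(k/2ⁿ)` is the DFT of `w_A`. [folklore] -/
theorem walshCoeff_eq_cubeDFT {n : ℕ} (A : Finset (Fin n)) (k : ℕ) :
    walshCoeff A ((k : ℝ) / 2 ^ n) = cubeDFT (fun x => (walshSign A x : ℂ)) k := by
  unfold walshCoeff cubeDFT
  congr 1
  refine Finset.sum_congr rfl fun x _ => ?_
  rw [div_mul_eq_mul_div, mul_div_assoc]

/-- The DFT is `2ⁿ`-periodic in `k`. [folklore] -/
theorem cubeDFT_add_two_pow {n : ℕ} (F : (Fin n → Bool) → ℂ) (k : ℕ) :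
    cubeDFT F (k + 2 ^ n) = cubeDFT F k := by
  unfold cubeDFT
  congr 1
  refine Finset.sum_congr rfl fun x _ => ?_
  rw [show (((k + 2 ^ n : ℕ) : ℝ) * ((bitsToNat (List.ofFn x) : ℝ) / 2 ^ n)) =
      k * ((bitsToNat (List.ofFn x) : ℝ) / 2 ^ n) + (bitsToNat (List.ofFn x) : ℕ) by
    push_cast; field_simp, eChar_add_natCast]

/-- **Convolution formula**: `(FG)^(k) = ∑_{k' < 2ⁿ} F̂(k') Ĝ(k + 2ⁿ - k')`. [folklore] -/
theorem cubeDFT_mul {n : ℕ} (F G : (Fin n → Bool) → ℂ) (k : ℕ) :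
    cubeDFT (fun x => F x * G x) k =
      ∑ k' ∈ range (2 ^ n), cubeDFT F k' * cubeDFT G (k + 2 ^ n - k') := by
  classical
  -- Step 1: expand each summand of the right-hand side.
  have hterm : ∀ k' ∈ range (2 ^ n), cubeDFT F k' * cubeDFT G (k + 2 ^ n - k') =
      ((2 : ℂ) ^ n)⁻¹ * ((2 : ℂ) ^ n)⁻¹ * ∑ x : Fin n → Bool, ∑ y : Fin n → Bool,
        F x * G y * eChar (k * ((bitsToNat (List.ofFn y) : ℝ) / 2 ^ n)) *
          eChar (k' * ((((bitsToNat (List.ofFn x) : ℤ) - (bitsToNat (List.ofFn y) : ℤ) : ℤ) : ℝ) /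
            2 ^ n)) := by
    intro k' hk'
    rw [Finset.mem_range] at hk'
    unfold cubeDFT
    rw [show ∀ a b : ℂ, ((2 : ℂ) ^ n)⁻¹ * a * (((2 : ℂ) ^ n)⁻¹ * b) =
        ((2 : ℂ) ^ n)⁻¹ * ((2 : ℂ) ^ n)⁻¹ * (a * b) from fun a b => by ring, Finset.sum_mul_sum]
    congr 1
    refine Finset.sum_congr rfl fun x _ => Finset.sum_congr rfl fun y _ => ?_
    have hcast : (((k + 2 ^ n - k' : ℕ) : ℝ)) = (k : ℝ) + 2 ^ n - k' := by
      rw [Nat.cast_sub (by omega)]; push_cast; ring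
    have hchar : eChar (k' * ((bitsToNat (List.ofFn x) : ℝ) / 2 ^ n)) *
        eChar (((k + 2 ^ n - k' : ℕ) : ℝ) * ((bitsToNat (List.ofFn y) : ℝ) / 2 ^ n)) =
        eChar (k * ((bitsToNat (List.ofFn y) : ℝ) / 2 ^ n)) *
          eChar (k' * ((((bitsToNat (List.ofFn x) : ℤ) - (bitsToNat (List.ofFn y) : ℤ) : ℤ) : ℝ) /
            2 ^ n)) := by
      rw [← eChar_add, ← eChar_add, hcast]
      rw [show (k' : ℝ) * ((bitsToNat (List.ofFn x) : ℝ) / 2 ^ n) +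
          ((k : ℝ) + 2 ^ n - k') * ((bitsToNat (List.ofFn y) : ℝ) / 2 ^ n) =
          ((k : ℝ) * ((bitsToNat (List.ofFn y) : ℝ) / 2 ^ n) +
            k' * ((((bitsToNat (List.ofFn x) : ℤ) - (bitsToNat (List.ofFn y) : ℤ) : ℤ) : ℝ) / 2 ^ n)) +
          (bitsToNat (List.ofFn y) : ℕ) by
        push_cast; field_simp; ring]
      exact eChar_add_natCast _ _
    calc F x * eChar (k' * ((bitsToNat (List.ofFn x) : ℝ) / 2 ^ n)) *
          (G y * eChar (((k + 2 ^ n - k' : ℕ) : ℝ) * ((bitsToNat (List.ofFn y) : ℝ) / 2 ^ n)))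
        = F x * G y * (eChar (k' * ((bitsToNat (List.ofFn x) : ℝ) / 2 ^ n)) *
            eChar (((k + 2 ^ n - k' : ℕ) : ℝ) * ((bitsToNat (List.ofFn y) : ℝ) / 2 ^ n))) := by ring
      _ = _ := by rw [hchar]; ring
  rw [Finset.sum_congr rfl hterm, ← Finset.mul_sum]
  -- Step 2: sum over `k'` first (orthogonality), then over `y`.
  rw [Finset.sum_comm]
  simp_rw [Finset.sum_comm (s := range (2 ^ n)), ← Finset.mul_sum, sum_eChar_mul_div,
    two_pow_dvd_sub_iff]
  simp_rw [mul_ite, mul_zero, Finset.sum_ite_eq, Finset.mem_univ, if_true]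
  unfold cubeDFT
  rw [Finset.mul_sum, Finset.mul_sum]
  refine Finset.sum_congr rfl fun x _ => ?_
  have hN : ((2 : ℂ) ^ n) ≠ 0 := pow_ne_zero _ two_ne_zero
  push_cast
  field_simp

/-- **`ℓ¹` submultiplicativity of the DFT**: `‖(FG)^‖₁ ≤ ‖F̂‖₁ ‖Ĝ‖₁` (sums over one period).
[folklore] -/
theorem sum_norm_cubeDFT_mul_le {n : ℕ} (F G : (Fin n → Bool) → ℂ) :
    ∑ k ∈ range (2 ^ n), ‖cubeDFT (fun x => F x * G x) k‖ ≤
      (∑ k ∈ range (2 ^ n), ‖cubeDFT F k‖) * ∑ k ∈ range (2 ^ n), ‖cubeDFT G k‖ := by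
  have hper : ∀ k, ‖cubeDFT G (k + 2 ^ n)‖ = ‖cubeDFT G k‖ := fun k => by rw [cubeDFT_add_two_pow]
  calc ∑ k ∈ range (2 ^ n), ‖cubeDFT (fun x => F x * G x) k‖
      = ∑ k ∈ range (2 ^ n), ‖∑ k' ∈ range (2 ^ n), cubeDFT F k' * cubeDFT G (k + 2 ^ n - k')‖ := by
        simp_rw [cubeDFT_mul]
    _ ≤ ∑ k ∈ range (2 ^ n), ∑ k' ∈ range (2 ^ n), ‖cubeDFT F k'‖ * ‖cubeDFT G (k + 2 ^ n - k')‖ :=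
        Finset.sum_le_sum fun k _ => (norm_sum_le _ _).trans (le_of_eq (Finset.sum_congr rfl
          fun k' _ => norm_mul _ _))
    _ = ∑ k' ∈ range (2 ^ n), ‖cubeDFT F k'‖ * ∑ k ∈ range (2 ^ n), ‖cubeDFT G (k + 2 ^ n - k')‖ := by
        rw [Finset.sum_comm]; simp_rw [Finset.mul_sum]
    _ = ∑ k' ∈ range (2 ^ n), ‖cubeDFT F k'‖ * ∑ k ∈ range (2 ^ n), ‖cubeDFT G k‖ := by
        refine Finset.sum_congr rfl fun k' hk' => ?_
        rw [Finset.mem_range] at hk'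
        congr 1
        have h := sum_range_add_eq_of_periodic (f := fun k => ‖cubeDFT G k‖) hper (2 ^ n - k')
        rw [← h]
        refine Finset.sum_congr rfl fun k _ => ?_
        rw [Nat.add_sub_assoc hk'.le]
    _ = (∑ k ∈ range (2 ^ n), ‖cubeDFT F k‖) * ∑ k ∈ range (2 ^ n), ‖cubeDFT G k‖ := by
        rw [Finset.sum_mul]

/-- The DFT of the constant function `1` is the delta mass at `k = 0` (for `k < 2ⁿ`). [folklore] -/
theorem cubeDFT_one {n : ℕ} {k : ℕ} (hk : k < 2 ^ n) :
    cubeDFT (fun _ : Fin n → Bool => (1 : ℂ)) k = if k = 0 then 1 else 0 := by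
  unfold cubeDFT
  simp_rw [one_mul]
  rw [sum_digits_eq_sum_range n (fun m => eChar (k * ((m : ℝ) / 2 ^ n)))]
  have h := sum_eChar_mul_div n (k : ℤ)
  simp_rw [show ∀ m : ℕ, ((m : ℝ) * (((k : ℤ) : ℝ) / 2 ^ n)) = k * ((m : ℝ) / 2 ^ n) from
    fun m => by push_cast; ring] at h
  rw [h]
  have hdvd : ((2 ^ n : ℤ) ∣ (k : ℤ)) ↔ k = 0 := by
    constructor
    · intro hd
      have hd' : (2 ^ n : ℕ) ∣ k := by exact_mod_cast hd
      exact Nat.eq_zero_of_dvd_of_lt hd' hk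
    · rintro rfl; simp
  simp_rw [hdvd]
  split_ifs
  · push_cast; field_simp
  · rw [mul_zero]

/-- `‖1̂‖₁ = 1`. [folklore] -/
theorem sum_norm_cubeDFT_one (n : ℕ) :
    ∑ k ∈ range (2 ^ n), ‖cubeDFT (fun _ : Fin n → Bool => (1 : ℂ)) k‖ = 1 := by
  rw [Finset.sum_congr rfl fun k hk => by rw [cubeDFT_one (Finset.mem_range.1 hk)]]
  simp_rw [apply_ite norm, norm_one, norm_zero]
  rw [Finset.sum_ite_eq' (range (2 ^ n)) 0 (fun _ => (1 : ℝ)), if_pos (Finset.mem_range.2 (Nat.two_pow_pos n))]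

/-- `w_∅ = 1`. [folklore] -/
@[simp] theorem walshSign_empty {n : ℕ} (x : Fin n → Bool) : walshSign (∅ : Finset (Fin n)) x = 1 := by
  simp [walshSign]

/-- `w_{A ∪ {j}} = w_{{j}} · w_A` for `j ∉ A`. [folklore] -/
theorem walshSign_insert {n : ℕ} {A : Finset (Fin n)} {j : Fin n} (hj : j ∉ A) (x : Fin n → Bool) :
    walshSign (insert j A) x = walshSign {j} x * walshSign A x := by
  unfold walshSign
  rw [Finset.prod_insert hj, Finset.prod_singleton]

/-! ### The single-digit `ℓ¹` bound and Lemma 1 (1.1) -/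

/-- **Doubling identity**: `|sin(2^L y)| = 2^L |sin y| ∏_{i<L} |cos(2^i y)|`. [folklore] -/
theorem abs_sin_two_pow_mul (y : ℝ) (L : ℕ) :
    |Real.sin (2 ^ L * y)| = 2 ^ L * |Real.sin y| * ∏ i ∈ range L, |Real.cos (2 ^ i * y)| := by
  induction L with
  | zero => simp
  | succ L ih =>
    rw [Finset.prod_range_succ, pow_succ, show (2 : ℝ) ^ L * 2 * y = 2 * (2 ^ L * y) by ring,
      Real.sin_two_mul, abs_mul, abs_mul, abs_two, ih]
    ring

/-- The digit phases of a singleton `{j}`. [folklore] -/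
theorem digitPhaseSeq_singleton {n : ℕ} (j : Fin n) (i : ℕ) :
    digitPhaseSeq ({j} : Finset (Fin n)) i = if i = (j : ℕ) then 1 / 2 else 0 := by
  unfold digitPhaseSeq digitPhase
  by_cases hi : i < n
  · simp only [dif_pos hi, Finset.mem_singleton, Fin.ext_iff]
  · rw [dif_neg hi, if_neg]
    intro h
    exact hi (h ▸ j.isLt)

/-- The three blocks of `|ŵ_{{j}}(t)|`: digits below `j`, digit `j`, digits above `j`.
[cite: Bourgain2013MoebiusWalsh, (1.2)] -/
theorem norm_walshCoeff_singleton_eq {n : ℕ} (j : Fin n) (t : ℝ) :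
    ‖walshCoeff ({j} : Finset (Fin n)) t‖ =
      (∏ i ∈ range (j : ℕ), |Real.cos (π * (2 ^ i * t))|) * |Real.sin (π * (2 ^ (j : ℕ) * t))| *
        ∏ i ∈ Ico ((j : ℕ) + 1) n, |Real.cos (π * (2 ^ i * t))| := by
  rw [norm_walshCoeff_eq_cosProd]
  unfold cosProd
  simp_rw [digitPhaseSeq_singleton]
  rw [← Finset.prod_range_mul_prod_Ico _ (Nat.succ_le_of_lt j.isLt), Finset.prod_range_succ]
  congr 1
  · congr 1
    · refine Finset.prod_congr rfl fun i hi => ?_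
      rw [Finset.mem_range] at hi
      rw [if_neg hi.ne, zero_add]
    · rw [if_pos rfl, mul_add, show π * (1 / 2 : ℝ) = π / 2 by ring, add_comm,
        Real.cos_add_pi_div_two, abs_neg]
  · refine Finset.prod_congr rfl fun i hi => ?_
    rw [Finset.mem_Ico] at hi
    rw [if_neg (by omega), zero_add]

/-- **The high block vanishes off the multiples of `2^{n-j-1}`**: at `t = k/2ⁿ`, either
`sin(π 2^{j+1} k/2ⁿ) = 0` (i.e. `2^{n-j-1} ∣ k`) or `∏_{j < i < n} |cos(π 2^i k/2ⁿ)| = 0` (the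
doubling identity with `sin(πk) = 0`). [folklore] -/
theorem high_block_dichotomy {n : ℕ} (j : Fin n) (k : ℕ) :
    Real.sin (π * (2 ^ ((j : ℕ) + 1) * ((k : ℝ) / 2 ^ n))) = 0 ∨
      ∏ i ∈ Ico ((j : ℕ) + 1) n, |Real.cos (π * (2 ^ i * ((k : ℝ) / 2 ^ n)))| = 0 := by
  set y := π * (2 ^ ((j : ℕ) + 1) * ((k : ℝ) / 2 ^ n)) with hy
  set L := n - ((j : ℕ) + 1) with hL
  have hjn : (j : ℕ) + 1 ≤ n := Nat.succ_le_of_lt j.isLt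
  have hprod : ∏ i ∈ Ico ((j : ℕ) + 1) n, |Real.cos (π * (2 ^ i * ((k : ℝ) / 2 ^ n)))| =
      ∏ i ∈ range L, |Real.cos (2 ^ i * y)| := by
    rw [Finset.prod_Ico_eq_prod_range]
    refine Finset.prod_congr rfl fun i _ => ?_
    rw [hy, pow_add]; ring_nf
  have h2n : (2 : ℝ) ^ n = 2 ^ L * 2 ^ ((j : ℕ) + 1) := by
    rw [← pow_add, hL, Nat.sub_add_cancel hjn]
  have hzero : Real.sin (2 ^ L * y) = 0 := by
    have : (2 : ℝ) ^ L * y = (k : ℝ) * π := by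
      rw [hy, h2n]; field_simp
    rw [this]
    exact Real.sin_nat_mul_pi k
  have hDI := abs_sin_two_pow_mul y L
  rw [hzero, abs_zero] at hDI
  rcases mul_eq_zero.1 hDI.symm with h | h
  · left
    rcases mul_eq_zero.1 h with h2 | h2
    · exact absurd h2 (pow_ne_zero _ two_ne_zero)
    · exact abs_eq_zero.1 h2
  · right
    rwa [hprod]

/-- The majorant of `|ŵ_{{j}}(k/2ⁿ)|`: zero unless `k = 2^{n-j-1} q` with `0 < q < 2^{j+1}`, and then
`1/(2^j |sin(πq/2^{j+1})|)`. [folklore] -/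
def singletonMajorant (n J k : ℕ) : ℝ :=
  if 2 ^ (n - (J + 1)) ∣ k then
    (if k / 2 ^ (n - (J + 1)) = 0 then 0 else
      1 / (2 ^ J * |Real.sin (π * (((k / 2 ^ (n - (J + 1)) : ℕ) : ℝ) / 2 ^ (J + 1)))|))
  else 0

/-- Off the multiples of `2^{n-J-1}` the majorant vanishes. [folklore] -/
theorem singletonMajorant_of_not_dvd {n J k : ℕ} (h : ¬ 2 ^ (n - (J + 1)) ∣ k) :
    singletonMajorant n J k = 0 := by
  unfold singletonMajorant
  rw [if_neg h]

/-- The majorant on the multiples of `2^{n-J-1}`. [folklore] -/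
theorem singletonMajorant_mul (n J q : ℕ) :
    singletonMajorant n J (2 ^ (n - (J + 1)) * q) =
      if q = 0 then 0 else 1 / (2 ^ J * |Real.sin (π * ((q : ℝ) / 2 ^ (J + 1)))|) := by
  unfold singletonMajorant
  rw [if_pos (Dvd.intro q rfl), Nat.mul_div_cancel_left q (pow_pos two_pos _)]

/-- `0 ≤ singletonMajorant`. [folklore] -/
theorem singletonMajorant_nonneg (n J k : ℕ) : 0 ≤ singletonMajorant n J k := by
  unfold singletonMajorant
  split_ifs <;> positivity

/-- **Pointwise bound for one digit**: `|ŵ_{{j}}(k/2ⁿ)| ≤ singletonMajorant n j k` (support on the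
multiples of `2^{n-j-1}` by `high_block_dichotomy`; there the low block times `2^j |sin(πq/2^{j+1})|`
equals `|sin(πq/2)| ≤ 1` by the doubling identity). [folklore] -/
theorem norm_walshCoeff_singleton_le {n : ℕ} (j : Fin n) (k : ℕ) :
    ‖walshCoeff ({j} : Finset (Fin n)) ((k : ℝ) / 2 ^ n)‖ ≤ singletonMajorant n j k := by
  have hjn : (j : ℕ) + 1 ≤ n := Nat.succ_le_of_lt j.isLt
  set L := n - ((j : ℕ) + 1) with hL
  have h2n : (2 : ℝ) ^ n = 2 ^ L * 2 ^ ((j : ℕ) + 1) := by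
    rw [← pow_add, hL, Nat.sub_add_cancel hjn]
  have hLo0 : 0 ≤ ∏ i ∈ range (j : ℕ), |Real.cos (π * (2 ^ i * ((k : ℝ) / 2 ^ n)))| :=
    Finset.prod_nonneg fun _ _ => abs_nonneg _
  have hHi0 : 0 ≤ ∏ i ∈ Ico ((j : ℕ) + 1) n, |Real.cos (π * (2 ^ i * ((k : ℝ) / 2 ^ n)))| :=
    Finset.prod_nonneg fun _ _ => abs_nonneg _
  have hHi1 : ∏ i ∈ Ico ((j : ℕ) + 1) n, |Real.cos (π * (2 ^ i * ((k : ℝ) / 2 ^ n)))| ≤ 1 :=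
    Finset.prod_le_one (fun _ _ => abs_nonneg _) fun _ _ => Real.abs_cos_le_one _
  rw [norm_walshCoeff_singleton_eq]
  unfold singletonMajorant
  split_ifs with hd hq
  · -- `k = 2^L q` with `q = 0`, so `k = 0` and the middle factor vanishes
    obtain ⟨q, rfl⟩ := hd
    rw [Nat.mul_div_cancel_left q (pow_pos two_pos _)] at hq
    subst hq
    simp
  · -- the main case `k = 2^L q`, `q ≠ 0`
    obtain ⟨q, rfl⟩ := hd
    rw [Nat.mul_div_cancel_left q (pow_pos two_pos _)] at hq ⊢
    have h2L : (2 : ℝ) ^ L ≠ 0 := pow_ne_zero _ two_ne_zero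
    set z := π * ((q : ℝ) / 2 ^ ((j : ℕ) + 1)) with hz
    have hmid : Real.sin (π * (2 ^ (j : ℕ) * (((2 ^ L * q : ℕ) : ℝ) / 2 ^ n))) =
        Real.sin (2 ^ (j : ℕ) * z) := by
      rw [hz, h2n]; push_cast; rw [mul_div_mul_left _ _ h2L, pow_succ]; congr 1; field_simp
    have hlo : ∏ i ∈ range (j : ℕ), |Real.cos (π * (2 ^ i * (((2 ^ L * q : ℕ) : ℝ) / 2 ^ n)))| =
        ∏ i ∈ range (j : ℕ), |Real.cos (2 ^ i * z)| := by
      refine Finset.prod_congr rfl fun i _ => ?_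
      rw [hz, h2n]; push_cast; rw [mul_div_mul_left _ _ h2L]; congr 2; ring
    have hDI := abs_sin_two_pow_mul z (j : ℕ)
    rw [hmid, hlo]
    by_cases hs : Real.sin z = 0
    · -- then the middle factor vanishes as well
      rw [hs, abs_zero, mul_zero, zero_mul] at hDI
      rw [hDI, mul_zero, zero_mul]
      positivity
    · have hs' : 0 < |Real.sin z| := abs_pos.2 hs
      have h2j : (0 : ℝ) < 2 ^ (j : ℕ) := pow_pos two_pos _
      -- low block = |sin(2^j z)| / (2^j |sin z|)
      have hlo' : ∏ i ∈ range (j : ℕ), |Real.cos (2 ^ i * z)| =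
          |Real.sin (2 ^ (j : ℕ) * z)| / (2 ^ (j : ℕ) * |Real.sin z|) := by
        rw [hDI, mul_div_cancel_left₀ _ (ne_of_gt (mul_pos h2j hs'))]
      rw [hlo']
      calc |Real.sin (2 ^ (j : ℕ) * z)| / (2 ^ (j : ℕ) * |Real.sin z|) * |Real.sin (2 ^ (j : ℕ) * z)| *
            ∏ i ∈ Ico ((j : ℕ) + 1) n, |Real.cos (π * (2 ^ i * (((2 ^ L * q : ℕ) : ℝ) / 2 ^ n)))|
          ≤ |Real.sin (2 ^ (j : ℕ) * z)| / (2 ^ (j : ℕ) * |Real.sin z|) * |Real.sin (2 ^ (j : ℕ) * z)| * 1 :=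
            mul_le_mul_of_nonneg_left hHi1 (by positivity)
        _ = |Real.sin (2 ^ (j : ℕ) * z)| ^ 2 / (2 ^ (j : ℕ) * |Real.sin z|) := by ring
        _ ≤ 1 / (2 ^ (j : ℕ) * |Real.sin z|) := by
            refine div_le_div_of_nonneg_right ?_ (by positivity)
            rw [sq_abs]; exact Real.sin_sq_le_one _
  · -- off the multiples of `2^L` the high block vanishes
    rcases high_block_dichotomy j k with h | h
    · exfalso
      apply hd
      obtain ⟨m, hm⟩ := Real.sin_eq_zero_iff.1 h
      have hπ : π ≠ 0 := Real.pi_ne_zero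
      have hkm : (k : ℝ) = m * 2 ^ L := by
        have h2L : (2 : ℝ) ^ L ≠ 0 := pow_ne_zero _ two_ne_zero
        have h2J : (2 : ℝ) ^ ((j : ℕ) + 1) ≠ 0 := pow_ne_zero _ two_ne_zero
        have e1 : (2 : ℝ) ^ ((j : ℕ) + 1) * ((k : ℝ) / 2 ^ n) = (k : ℝ) / 2 ^ L := by
          rw [h2n, ← mul_div_assoc, mul_comm ((2 : ℝ) ^ ((j : ℕ) + 1)) (k : ℝ),
            mul_div_mul_right _ _ h2J]
        rw [e1] at hm
        -- `hm : m * π = π * (k / 2^L)`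
        have e2 : (m : ℝ) = (k : ℝ) / 2 ^ L := mul_right_cancel₀ hπ (hm.trans (mul_comm _ _))
        rw [e2, div_mul_cancel₀ _ h2L]
      have hkm' : (k : ℤ) = m * (2 ^ L : ℕ) := by exact_mod_cast hkm
      have : ((2 ^ L : ℕ) : ℤ) ∣ (k : ℤ) := ⟨m, by rw [hkm']; ring⟩
      exact_mod_cast this
    · rw [h, mul_zero]

/-- The Jordan-type bound `1/(2^j |sin(πq/2^{j+1})|) ≤ 1/q + 1/(2^{j+1} - q)` for `0 < q < 2^{j+1}`.
[folklore] -/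
theorem one_div_two_pow_mul_abs_sin_le (J : ℕ) {q : ℕ} (hq1 : 1 ≤ q) (hq2 : q < 2 ^ (J + 1)) :
    1 / (2 ^ J * |Real.sin (π * ((q : ℝ) / 2 ^ (J + 1)))|) ≤
      1 / (q : ℝ) + 1 / ((2 ^ (J + 1) : ℝ) - q) := by
  have hM : (2 : ℝ) ^ (J + 1) = 2 * 2 ^ J := by rw [pow_succ]; ring
  have hq0 : (0 : ℝ) < q := by exact_mod_cast hq1
  have hMq : (0 : ℝ) < 2 ^ (J + 1) - q := by
    have : ((q : ℕ) : ℝ) < ((2 ^ (J + 1) : ℕ) : ℝ) := by exact_mod_cast hq2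
    push_cast at this; linarith
  -- Jordan's inequality: `sin(π t) ≥ 2t` on `[0, 1/2]`
  have jordan : ∀ t : ℝ, 0 ≤ t → t ≤ 1 / 2 → 2 * t ≤ Real.sin (π * t) := by
    intro t ht0 ht1
    have h := Real.mul_le_sin (x := π * t) (by positivity)
      (by rw [show π / 2 = π * (1 / 2) by ring]; exact mul_le_mul_of_nonneg_left ht1 Real.pi_pos.le)
    rwa [show 2 / π * (π * t) = 2 * t by field_simp] at h
  by_cases hcase : 2 * q ≤ 2 ^ (J + 1)
  · -- `q ≤ M/2`: `sin ≥ 2q/M = q/2^J`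
    have ht1 : (q : ℝ) / 2 ^ (J + 1) ≤ 1 / 2 := by
      rw [div_le_iff₀ (by positivity)]
      have : ((2 * q : ℕ) : ℝ) ≤ ((2 ^ (J + 1) : ℕ) : ℝ) := by exact_mod_cast hcase
      push_cast at this; linarith
    have hsin := jordan _ (by positivity) ht1
    have hsin' : (q : ℝ) / 2 ^ J ≤ |Real.sin (π * ((q : ℝ) / 2 ^ (J + 1)))| := by
      refine le_trans (le_of_eq ?_) (hsin.trans (le_abs_self _))
      rw [hM]; field_simp
    calc 1 / (2 ^ J * |Real.sin (π * ((q : ℝ) / 2 ^ (J + 1)))|) ≤ 1 / (2 ^ J * ((q : ℝ) / 2 ^ J)) :=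
          one_div_le_one_div_of_le (by positivity) (mul_le_mul_of_nonneg_left hsin' (by positivity))
      _ = 1 / (q : ℝ) := by field_simp
      _ ≤ 1 / (q : ℝ) + 1 / ((2 ^ (J + 1) : ℝ) - q) := le_add_of_nonneg_right (by positivity)
  · -- `q > M/2`: use `sin(π - x) = sin x` with `M - q < M/2`
    push Not at hcase
    have ht1 : ((2 ^ (J + 1) : ℝ) - q) / 2 ^ (J + 1) ≤ 1 / 2 := by
      rw [div_le_iff₀ (by positivity)]
      have : ((2 ^ (J + 1) : ℕ) : ℝ) < ((2 * q : ℕ) : ℝ) := by exact_mod_cast hcase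
      push_cast at this; linarith
    have hsin := jordan _ (by positivity) ht1
    have hrefl : Real.sin (π * (((2 ^ (J + 1) : ℝ) - q) / 2 ^ (J + 1))) =
        Real.sin (π * ((q : ℝ) / 2 ^ (J + 1))) := by
      rw [← Real.sin_pi_sub]; congr 1; field_simp; ring
    rw [hrefl] at hsin
    have hsin' : ((2 ^ (J + 1) : ℝ) - q) / 2 ^ J ≤ |Real.sin (π * ((q : ℝ) / 2 ^ (J + 1)))| := by
      refine le_trans (le_of_eq ?_) (hsin.trans (le_abs_self _))
      rw [hM]; field_simp
    calc 1 / (2 ^ J * |Real.sin (π * ((q : ℝ) / 2 ^ (J + 1)))|)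
        ≤ 1 / (2 ^ J * (((2 ^ (J + 1) : ℝ) - q) / 2 ^ J)) :=
          one_div_le_one_div_of_le (by positivity) (mul_le_mul_of_nonneg_left hsin' (by positivity))
      _ = 1 / ((2 ^ (J + 1) : ℝ) - q) := by field_simp
      _ ≤ 1 / (q : ℝ) + 1 / ((2 ^ (J + 1) : ℝ) - q) := le_add_of_nonneg_left (by positivity)

/-- **Dyadic harmonic bound**: `∑_{1 ≤ q < 2^m} 1/q ≤ m`. [folklore] -/
theorem sum_Ico_one_div_le (m : ℕ) : ∑ q ∈ Ico (1 : ℕ) (2 ^ m), 1 / (q : ℝ) ≤ m := by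
  induction m with
  | zero => simp
  | succ m ih =>
    rw [← Finset.sum_Ico_consecutive _ (Nat.one_le_two_pow)
      (Nat.pow_le_pow_right two_pos (Nat.le_succ m) : 2 ^ m ≤ 2 ^ (m + 1))]
    have hblock : ∑ q ∈ Ico (2 ^ m : ℕ) (2 ^ (m + 1)), 1 / (q : ℝ) ≤ 1 := by
      calc ∑ q ∈ Ico (2 ^ m : ℕ) (2 ^ (m + 1)), 1 / (q : ℝ)
          ≤ (Ico (2 ^ m : ℕ) (2 ^ (m + 1))).card • (1 / (2 : ℝ) ^ m) := by
            refine Finset.sum_le_card_nsmul _ _ _ fun q hq => ?_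
            rw [Finset.mem_Ico] at hq
            have : ((2 ^ m : ℕ) : ℝ) ≤ q := by exact_mod_cast hq.1
            push_cast at this
            exact one_div_le_one_div_of_le (by positivity) this
        _ = 1 := by
            rw [Nat.card_Ico, pow_succ, show 2 ^ m * 2 - 2 ^ m = 2 ^ m by omega, nsmul_eq_mul]
            push_cast
            field_simp
    push_cast
    linarith

/-- **The single-digit `ℓ¹` bound**: `∑_{k < 2ⁿ} |ŵ_{{j}}(k/2ⁿ)| ≤ 2(j + 1)` (Bourgain 2013,
display before Lemma 1: "`h(x/2^{j+1}) = ∑_{|r| < 2^{j+1}} a_{r,j} e(rx/2^{j+1})` with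
`∑ |a_r| ≲ j`"). [cite: Bourgain2013MoebiusWalsh, (1.0)–(1.1)] -/
theorem sum_norm_walshCoeff_singleton_le {n : ℕ} (j : Fin n) :
    ∑ k ∈ range (2 ^ n), ‖walshCoeff ({j} : Finset (Fin n)) ((k : ℝ) / 2 ^ n)‖ ≤ 2 * ((j : ℕ) + 1) := by
  have hjn : (j : ℕ) + 1 ≤ n := Nat.succ_le_of_lt j.isLt
  set J := (j : ℕ) with hJ
  set L := n - (J + 1) with hL
  have hN : 2 ^ n = 2 ^ L * 2 ^ (J + 1) := by rw [← pow_add, hL, Nat.sub_add_cancel hjn]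
  have hD : 0 < 2 ^ L := pow_pos two_pos _
  -- the reduced majorant on `q < 2^{J+1}`
  set β : ℕ → ℝ := fun q => if q = 0 then 0 else
    1 / (2 ^ J * |Real.sin (π * ((q : ℝ) / 2 ^ (J + 1)))|) with hβ
  have hLdef : n - (J + 1) = L := hL.symm
  calc ∑ k ∈ range (2 ^ n), ‖walshCoeff ({j} : Finset (Fin n)) ((k : ℝ) / 2 ^ n)‖
      ≤ ∑ k ∈ range (2 ^ n), singletonMajorant n J k :=
        Finset.sum_le_sum fun k _ => norm_walshCoeff_singleton_le j k
    _ = ∑ q ∈ range (2 ^ (J + 1)), ∑ k ∈ range (2 ^ L), singletonMajorant n J (k + 2 ^ L * q) := by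
        rw [hN, sum_range_mul_eq_sum_sum]
    _ = ∑ q ∈ range (2 ^ (J + 1)), β q := by
        refine Finset.sum_congr rfl fun q _ => ?_
        rw [Finset.sum_eq_single_of_mem 0 (Finset.mem_range.2 hD)]
        · -- the term `k = 0`
          rw [hβ, zero_add]
          dsimp only
          rw [← singletonMajorant_mul n J q, hLdef]
        · intro k hk hk0
          rw [Finset.mem_range] at hk
          apply singletonMajorant_of_not_dvd
          rw [hLdef]
          intro hdvd
          have : 2 ^ L ∣ k := (Nat.dvd_add_right (Dvd.intro q rfl)).1 (by rwa [add_comm] at hdvd)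
          exact hk0 (Nat.eq_zero_of_dvd_of_lt this hk)
    _ = ∑ q ∈ Ico (1 : ℕ) (2 ^ (J + 1)), 1 / (2 ^ J * |Real.sin (π * (((q : ℕ) : ℝ) / 2 ^ (J + 1)))|) := by
        rw [Finset.range_eq_Ico, Finset.sum_eq_sum_Ico_succ_bot (Nat.two_pow_pos _), hβ]
        dsimp only
        rw [if_pos rfl, zero_add]
        refine Finset.sum_congr rfl fun q hq => ?_
        rw [Finset.mem_Ico] at hq
        rw [if_neg (by omega)]
    _ ≤ ∑ q ∈ Ico (1 : ℕ) (2 ^ (J + 1)), (1 / ((q : ℕ) : ℝ) + 1 / ((2 ^ (J + 1) : ℝ) - ((q : ℕ) : ℝ))) := by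
        refine Finset.sum_le_sum fun q hq => ?_
        rw [Finset.mem_Ico] at hq
        exact one_div_two_pow_mul_abs_sin_le J hq.1 hq.2
    _ = 2 * ∑ q ∈ Ico (1 : ℕ) (2 ^ (J + 1)), 1 / ((q : ℕ) : ℝ) := by
        rw [Finset.sum_add_distrib, two_mul]
        congr 1
        have h := Finset.sum_Ico_reflect (fun i : ℕ => 1 / (i : ℝ)) 1 (Nat.le_succ (2 ^ (J + 1)))
        rw [show 2 ^ (J + 1) + 1 - 2 ^ (J + 1) = 1 by omega, Nat.add_sub_cancel] at h
        rw [← h]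
        refine Finset.sum_congr rfl fun q hq => ?_
        rw [Finset.mem_Ico] at hq
        rw [Nat.cast_sub (by omega)]
        push_cast
        ring
    _ ≤ 2 * ((J + 1 : ℕ) : ℝ) := by
        have := sum_Ico_one_div_le (J + 1)
        linarith
    _ = 2 * ((j : ℕ) + 1) := by push_cast; ring

/-- **Bourgain 2013, Lemma 1 (1.1)**, sharp-in-positions form:
`∑_{k < 2ⁿ} |ŵ_A(k/2ⁿ)| ≤ ∏_{j ∈ A} 2(j + 1)` (`ℓ¹` submultiplicativity of the DFT and the
single-digit bound). [cite: Bourgain2013MoebiusWalsh, Lemma 1 (1.1)] -/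
theorem sum_norm_walshCoeff_le_prod {n : ℕ} (A : Finset (Fin n)) :
    ∑ k ∈ range (2 ^ n), ‖walshCoeff A ((k : ℝ) / 2 ^ n)‖ ≤ ∏ j ∈ A, (2 * ((j : ℕ) + 1) : ℝ) := by
  classical
  induction A using Finset.induction_on with
  | empty =>
    simp_rw [walshCoeff_eq_cubeDFT, walshSign_empty, Complex.ofReal_one]
    rw [sum_norm_cubeDFT_one, Finset.prod_empty]
  | insert j A hj ih =>
    rw [Finset.prod_insert hj]
    calc ∑ k ∈ range (2 ^ n), ‖walshCoeff (insert j A) ((k : ℝ) / 2 ^ n)‖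
        = ∑ k ∈ range (2 ^ n),
            ‖cubeDFT (fun x => (walshSign {j} x : ℂ) * (walshSign A x : ℂ)) k‖ := by
          refine Finset.sum_congr rfl fun k _ => ?_
          rw [walshCoeff_eq_cubeDFT]
          simp_rw [walshSign_insert hj, Complex.ofReal_mul]
      _ ≤ (∑ k ∈ range (2 ^ n), ‖cubeDFT (fun x => (walshSign {j} x : ℂ)) k‖) *
            ∑ k ∈ range (2 ^ n), ‖cubeDFT (fun x => (walshSign A x : ℂ)) k‖ :=
          sum_norm_cubeDFT_mul_le _ _
      _ = (∑ k ∈ range (2 ^ n), ‖walshCoeff ({j} : Finset (Fin n)) ((k : ℝ) / 2 ^ n)‖) *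
            ∑ k ∈ range (2 ^ n), ‖walshCoeff A ((k : ℝ) / 2 ^ n)‖ := by
          simp_rw [walshCoeff_eq_cubeDFT]
      _ ≤ 2 * ((j : ℕ) + 1) * ∏ j ∈ A, (2 * ((j : ℕ) + 1) : ℝ) :=
          mul_le_mul (sum_norm_walshCoeff_singleton_le j) ih
            (Finset.sum_nonneg fun _ _ => norm_nonneg _) (by positivity)

/-- **Bourgain 2013, Lemma 1 (1.1), as printed**: "`∑ |ŵ_A(k)| < (Cλ)^{|A|}`" — here
`∑_{k < 2ⁿ} |ŵ_A(k/2ⁿ)| ≤ (2n)^{|A|}`. [cite: Bourgain2013MoebiusWalsh, Lemma 1 (1.1)] -/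
theorem bourgain2013_lemma1 {n : ℕ} (A : Finset (Fin n)) :
    ∑ k ∈ range (2 ^ n), ‖walshCoeff A ((k : ℝ) / 2 ^ n)‖ ≤ (2 * n : ℝ) ^ A.card := by
  refine (sum_norm_walshCoeff_le_prod A).trans ?_
  rw [← Finset.prod_const]
  refine Finset.prod_le_prod (fun j _ => by positivity) fun j _ => ?_
  have h : ((j : ℕ) : ℝ) + 1 ≤ n := by exact_mod_cast Nat.succ_le_of_lt j.isLt
  linarith

/-! ### Sums along progressions `k ≡ a (mod 2^r)` (Lemma 4) -/

/-- Keeping only the low `m` digit factors: `P_n(u; t) ≤ P_m(u; t)` for `m ≤ n`. [folklore] -/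
theorem cosProd_le_cosProd_low (u : ℕ → ℝ) {m n : ℕ} (hmn : m ≤ n) (t : ℝ) :
    cosProd u n t ≤ cosProd u m t := by
  unfold cosProd
  rw [← Finset.prod_range_mul_prod_Ico _ hmn]
  exact mul_le_of_le_one_right (Finset.prod_nonneg fun _ _ => abs_nonneg _)
    (Finset.prod_le_one (fun _ _ => abs_nonneg _) fun _ _ => Real.abs_cos_le_one _)

/-- **Bourgain 2013, Lemma 4** (progressions), parametrised form: for `r ≤ n` and any `a`,
`∑_{k₁ < 2^{n-r}} |ŵ_A((a + 2^r k₁)/2ⁿ)| ≤ 2 · 2^{κ(n-r)}`, `κ = log₂(2+√2)/4 = 1/2 - c`.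
DEVIATION (shorter road): the paper ((1.8)–(1.10)) perturbs the low factors and re-expands over
subsets `B` to come back to Lemma 3 for phases in `{0, 1/2}`; here Lemma 3 was proved for ARBITRARY
phase sequences (`cosProdSum_le_rpow`), so it applies directly to the shifted phases
`u_i + 2^i a/2ⁿ` after dropping the top `r` factors. [cite: Bourgain2013MoebiusWalsh, Lemma 4 (1.7)] -/
theorem sum_norm_walshCoeff_progression_le {n r : ℕ} (A : Finset (Fin n)) (hr : r ≤ n) (a : ℕ) :
    ∑ k₁ ∈ range (2 ^ (n - r)), ‖walshCoeff A (((a : ℝ) + 2 ^ r * k₁) / 2 ^ n)‖ ≤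
      2 * (2 : ℝ) ^ (walshL1Exponent * (n - r : ℕ)) := by
  set u' : ℕ → ℝ := fun i => digitPhaseSeq A i + 2 ^ i * ((a : ℝ) / 2 ^ n) with hu'
  have h2 : (2 : ℝ) ^ n = 2 ^ (n - r) * 2 ^ r := by rw [← pow_add, Nat.sub_add_cancel hr]
  have hle : ∀ k₁ : ℕ, ‖walshCoeff A (((a : ℝ) + 2 ^ r * k₁) / 2 ^ n)‖ ≤
      cosProd u' (n - r) ((k₁ : ℝ) / 2 ^ (n - r)) := by
    intro k₁
    rw [norm_walshCoeff_eq_cosProd]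
    refine (cosProd_le_cosProd_low _ (Nat.sub_le n r) _).trans (le_of_eq ?_)
    unfold cosProd
    refine Finset.prod_congr rfl fun i _ => ?_
    rw [hu']
    dsimp only
    rw [h2]
    congr 2
    field_simp
    ring
  calc ∑ k₁ ∈ range (2 ^ (n - r)), ‖walshCoeff A (((a : ℝ) + 2 ^ r * k₁) / 2 ^ n)‖
      ≤ ∑ k₁ ∈ range (2 ^ (n - r)), cosProd u' (n - r) ((k₁ : ℝ) / 2 ^ (n - r)) :=
        Finset.sum_le_sum fun k₁ _ => hle k₁
    _ = cosProdSum u' (n - r) := rfl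
    _ ≤ 2 * (2 : ℝ) ^ (walshL1Exponent * (n - r : ℕ)) := cosProdSum_le_rpow _ _

/-- **Bourgain 2013, Lemma 4, as printed**: "Let `r < λ`, `a = 0, 1, …, 2^r - 1`. Then
`∑_{k ≡ a (mod 2^r)} |ŵ_A(k)| ≲ 2^{(1/2 - c)(λ - r)}`" — the sum over `k < 2ⁿ` in the residue class
of `a < 2^r`, bounded by `2 · 2^{κ(n-r)}`. [cite: Bourgain2013MoebiusWalsh, Lemma 4 (1.7)] -/
theorem bourgain2013_lemma4 {n r : ℕ} (A : Finset (Fin n)) (hr : r ≤ n) {a : ℕ} (ha : a < 2 ^ r) :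
    ∑ k ∈ (range (2 ^ n)).filter (fun k => k % 2 ^ r = a), ‖walshCoeff A ((k : ℝ) / 2 ^ n)‖ ≤
      2 * (2 : ℝ) ^ (walshL1Exponent * (n - r : ℕ)) := by
  rw [Finset.sum_filter, show 2 ^ n = 2 ^ r * 2 ^ (n - r) by rw [← pow_add, Nat.add_sub_cancel' hr],
    sum_range_mul_eq_sum_sum]
  refine le_trans (le_of_eq ?_) (sum_norm_walshCoeff_progression_le A hr a)
  refine Finset.sum_congr rfl fun k₁ _ => ?_
  rw [Finset.sum_eq_single_of_mem a (Finset.mem_range.2 ha)]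
  · rw [if_pos (by rw [Nat.add_mul_mod_self_left, Nat.mod_eq_of_lt ha])]
    push_cast
    ring_nf
  · intro k hk hka
    rw [Finset.mem_range] at hk
    rw [if_neg]
    rwa [Nat.add_mul_mod_self_left, Nat.mod_eq_of_lt hk]

/-! ### The `ℓ¹` bound for top-heavy `A` (Lemma 5, (1.11)) -/

/-- `|sin (x + m π)| = |sin x|` for a natural number `m`. [folklore] -/
theorem abs_sin_add_nat_mul_pi (x : ℝ) (m : ℕ) : |Real.sin (x + m * π)| = |Real.sin x| := by
  rw [Real.sin_add_nat_mul_pi, abs_mul, abs_pow, abs_neg, abs_one, one_pow, one_mul]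

/-- Splitting `P_n(u; t)` into the low `m` digits and the high `n - m` digits:
`P_n(u; t) = P_m(u; t) · P_{n-m}(u(m + ·); 2^m t)`. [folklore] -/
theorem cosProd_split (u : ℕ → ℝ) {m n : ℕ} (hmn : m ≤ n) (t : ℝ) :
    cosProd u n t = cosProd u m t * cosProd (fun i => u (m + i)) (n - m) (2 ^ m * t) := by
  unfold cosProd
  rw [← Finset.prod_range_mul_prod_Ico _ hmn, Finset.prod_Ico_eq_prod_range]
  congr 1
  refine Finset.prod_congr rfl fun i _ => ?_
  rw [pow_add]; ring_nf

/-- The **Dirichlet-type kernel** `D_m(x) = ∏_{i<m} |cos(π 2^i x)|` (all phases `0`) satisfies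
`D_m((θ + k)/2^m) ≤ 1/(2k) + 1/(2(2^m - 1 - k))` for `θ ∈ [0, 1]` and `1 ≤ k ≤ 2^m - 2`
(doubling identity: `D_m(x) · 2^m |sin πx| = |sin πθ| ≤ 1`, then Jordan on both halves). [folklore] -/
theorem cosProd_zero_shift_le (m : ℕ) {θ : ℝ} (h0 : 0 ≤ θ) (h1 : θ ≤ 1) {k : ℕ} (hk1 : 1 ≤ k)
    (hk2 : k + 2 ≤ 2 ^ m) :
    cosProd (fun _ => 0) m ((θ + k) / 2 ^ m) ≤
      1 / (2 * (k : ℝ)) + 1 / (2 * (((2 ^ m : ℕ) : ℝ) - 1 - k)) := by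
  set x : ℝ := (θ + k) / 2 ^ m with hx
  have h2m : (0 : ℝ) < 2 ^ m := pow_pos two_pos _
  have hM : ((2 ^ m : ℕ) : ℝ) = (2 : ℝ) ^ m := by push_cast; ring
  have hk0 : (1 : ℝ) ≤ k := by exact_mod_cast hk1
  have hkM : (k : ℝ) + 2 ≤ 2 ^ m := by
    have : ((k + 2 : ℕ) : ℝ) ≤ ((2 ^ m : ℕ) : ℝ) := by exact_mod_cast hk2
    push_cast at this; linarith
  have hx0 : 0 < x := by rw [hx]; positivity
  have hx1 : x < 1 := by rw [hx, div_lt_one h2m]; linarith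
  -- `D_m(x) · 2^m |sin πx| = |sin πθ|`
  have hD : cosProd (fun _ => 0) m x = ∏ i ∈ range m, |Real.cos (2 ^ i * (π * x))| := by
    unfold cosProd
    refine Finset.prod_congr rfl fun i _ => ?_
    rw [zero_add]; ring_nf
  have hDI := abs_sin_two_pow_mul (π * x) m
  have htop : |Real.sin (2 ^ m * (π * x))| = |Real.sin (π * θ)| := by
    rw [hx, show (2 : ℝ) ^ m * (π * ((θ + k) / 2 ^ m)) = π * θ + k * π by field_simp]
    exact abs_sin_add_nat_mul_pi _ _
  have hsinx : 0 < Real.sin (π * x) := Real.sin_pos_of_pos_of_lt_pi (by positivity)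
    (by nlinarith [Real.pi_pos])
  have hDeq : cosProd (fun _ => 0) m x = |Real.sin (π * θ)| / (2 ^ m * |Real.sin (π * x)|) := by
    rw [hD, eq_div_iff (ne_of_gt (by positivity)), ← htop, hDI]; ring
  have hsinθ : |Real.sin (π * θ)| ≤ 1 := Real.abs_sin_le_one _
  -- Jordan's inequality: `sin(π t) ≥ 2t` on `[0, 1/2]`
  have jordan : ∀ t : ℝ, 0 ≤ t → t ≤ 1 / 2 → 2 * t ≤ Real.sin (π * t) := by
    intro t ht0 ht1
    have h := Real.mul_le_sin (x := π * t) (by positivity)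
      (by rw [show π / 2 = π * (1 / 2) by ring]; exact mul_le_mul_of_nonneg_left ht1 Real.pi_pos.le)
    rwa [show 2 / π * (π * t) = 2 * t by field_simp] at h
  rw [hDeq, abs_of_pos hsinx]
  have hpos1 : (0 : ℝ) < 2 * k := by positivity
  have hpos2 : (0 : ℝ) < 2 * (((2 ^ m : ℕ) : ℝ) - 1 - k) := by rw [hM]; linarith
  by_cases hhalf : x ≤ 1 / 2
  · -- lower half: `sin πx ≥ 2x`, and `2^m · 2x = 2(θ + k) ≥ 2k`
    have hs := jordan x hx0.le hhalf
    calc |Real.sin (π * θ)| / (2 ^ m * Real.sin (π * x)) ≤ 1 / (2 ^ m * (2 * x)) := by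
          rw [div_le_div_iff₀ (by positivity) (by positivity)]
          nlinarith [mul_le_mul hsinθ hs (by positivity) zero_le_one]
      _ ≤ 1 / (2 * (k : ℝ)) := by
          refine one_div_le_one_div_of_le hpos1 ?_
          rw [hx]; field_simp; linarith
      _ ≤ 1 / (2 * (k : ℝ)) + 1 / (2 * (((2 ^ m : ℕ) : ℝ) - 1 - k)) :=
          le_add_of_nonneg_right (le_of_lt (one_div_pos.2 hpos2))
  · -- upper half: `sin πx = sin π(1 - x) ≥ 2(1 - x)`, and `2^m · 2(1-x) = 2(2^m - θ - k) ≥ 2(2^m - 1 - k)`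
    push Not at hhalf
    have hs := jordan (1 - x) (by linarith) (by linarith)
    rw [show π * (1 - x) = π - π * x by ring, Real.sin_pi_sub] at hs
    calc |Real.sin (π * θ)| / (2 ^ m * Real.sin (π * x)) ≤ 1 / (2 ^ m * (2 * (1 - x))) := by
          rw [div_le_div_iff₀ (by positivity) (by nlinarith)]
          nlinarith [mul_le_mul hsinθ hs (by linarith) zero_le_one]
      _ ≤ 1 / (2 * (((2 ^ m : ℕ) : ℝ) - 1 - k)) := by
          refine one_div_le_one_div_of_le hpos2 ?_
          rw [hM, hx]; field_simp; linarith
      _ ≤ 1 / (2 * (k : ℝ)) + 1 / (2 * (((2 ^ m : ℕ) : ℝ) - 1 - k)) :=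
          le_add_of_nonneg_left (le_of_lt (one_div_pos.2 hpos1))

/-- **`ℓ¹` bound of the Dirichlet-type kernel over a shifted grid**:
`∑_{k < 2^m} D_m((θ + k)/2^m) ≤ m + 2` for `θ ∈ [0, 1]` (the two extreme terms are `≤ 1`, the
others are handled by `cosProd_zero_shift_le` and the dyadic harmonic bound). [folklore] -/
theorem sum_cosProd_zero_shift_le (m : ℕ) {θ : ℝ} (h0 : 0 ≤ θ) (h1 : θ ≤ 1) :
    ∑ k ∈ range (2 ^ m), cosProd (fun _ => 0) m ((θ + k) / 2 ^ m) ≤ m + 2 := by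
  have hle1 : ∀ k : ℕ, cosProd (fun _ => (0 : ℝ)) m ((θ + k) / 2 ^ m) ≤ 1 := fun k => cosProd_le_one _ _ _
  rcases Nat.lt_or_ge (2 ^ m) 3 with hsmall | hbig
  · -- `2^m ≤ 2`: at most two terms, each `≤ 1`
    calc ∑ k ∈ range (2 ^ m), cosProd (fun _ => 0) m ((θ + k) / 2 ^ m)
        ≤ ∑ _k ∈ range (2 ^ m), (1 : ℝ) := Finset.sum_le_sum fun k _ => hle1 k
      _ = ((2 ^ m : ℕ) : ℝ) := by simp
      _ ≤ 2 := by exact_mod_cast (by omega : 2 ^ m ≤ 2)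
      _ ≤ m + 2 := by have : (0 : ℝ) ≤ m := Nat.cast_nonneg _; linarith
  · -- split off `k = 0` and `k = 2^m - 1`
    have hM1 : 1 ≤ 2 ^ m - 1 := by omega
    rw [Finset.range_eq_Ico, Finset.sum_eq_sum_Ico_succ_bot (Nat.two_pow_pos m),
      show 2 ^ m = (2 ^ m - 1) + 1 from (Nat.sub_add_cancel Nat.one_le_two_pow).symm,
      Finset.sum_Ico_succ_top hM1]
    have hmid : ∑ k ∈ Ico (1 : ℕ) (2 ^ m - 1), cosProd (fun _ => (0 : ℝ)) m ((θ + k) / 2 ^ m) ≤ m := by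
      calc ∑ k ∈ Ico (1 : ℕ) (2 ^ m - 1), cosProd (fun _ => (0 : ℝ)) m ((θ + k) / 2 ^ m)
          ≤ ∑ k ∈ Ico (1 : ℕ) (2 ^ m - 1), (1 / (2 * (k : ℝ)) + 1 / (2 * (((2 ^ m : ℕ) : ℝ) - 1 - k))) := by
            refine Finset.sum_le_sum fun k hk => ?_
            rw [Finset.mem_Ico] at hk
            exact cosProd_zero_shift_le m h0 h1 hk.1 (by omega)
        _ = ∑ k ∈ Ico (1 : ℕ) (2 ^ m - 1), 1 / (k : ℝ) := by
            rw [Finset.sum_add_distrib]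
            have href : ∑ k ∈ Ico (1 : ℕ) (2 ^ m - 1), 1 / (2 * (((2 ^ m : ℕ) : ℝ) - 1 - k)) =
                ∑ k ∈ Ico (1 : ℕ) (2 ^ m - 1), 1 / (2 * (k : ℝ)) := by
              have h := Finset.sum_Ico_reflect (fun i : ℕ => 1 / (2 * (i : ℝ))) 1
                (Nat.le_succ (2 ^ m - 1))
              rw [show 2 ^ m - 1 + 1 - (2 ^ m - 1) = 1 by omega, Nat.add_sub_cancel] at h
              rw [← h]
              refine Finset.sum_congr rfl fun k hk => ?_
              rw [Finset.mem_Ico] at hk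
              rw [Nat.cast_sub (by omega), Nat.cast_sub Nat.one_le_two_pow]
              push_cast
              ring
            rw [href, ← Finset.sum_add_distrib]
            refine Finset.sum_congr rfl fun k hk => ?_
            rw [Finset.mem_Ico] at hk
            have : (0 : ℝ) < k := by exact_mod_cast hk.1
            field_simp
            ring
        _ ≤ ∑ k ∈ Ico (1 : ℕ) (2 ^ m), 1 / (k : ℝ) :=
            Finset.sum_le_sum_of_subset_of_nonneg (Finset.Ico_subset_Ico_right (Nat.sub_le _ _))
              fun k _ _ => by positivity
        _ ≤ m := sum_Ico_one_div_le m
    have hfirst := hle1 0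
    have hlast := hle1 (2 ^ m - 1)
    push_cast at hfirst
    linarith

/-- The digit phases of `A` vanish below `m` when every element of `A` is `≥ m`. [folklore] -/
theorem digitPhaseSeq_eq_zero_of_lt {n m : ℕ} (A : Finset (Fin n)) (hA : ∀ j ∈ A, m ≤ (j : ℕ))
    {i : ℕ} (hi : i < m) : digitPhaseSeq A i = 0 := by
  unfold digitPhaseSeq digitPhase
  split_ifs with h hmem
  · exact absurd (hA _ hmem) (by simp; omega)
  · rfl
  · rfl

/-- **Bourgain 2013, Lemma 5, (1.11)** — the `ℓ¹` bound for top-heavy sets, in a STRONGER form: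
if every element of `A` is `≥ m` (`A ⊂ [λ - σ, λ]` with `σ = n - m` in the paper), then
`∑_{k < 2ⁿ} |ŵ_A(k/2ⁿ)| ≤ 2 (m + 2) · 2^{κ(n - m)}` (the paper prints `C^{(log λ)²} (2^σ)^{1/2 - c}`).
Proof: split `k = k₀ + 2^σ k₁`; the high `σ` factors give `|ŵ_{A - m}(k₀/2^σ)|` ((1.14)–(1.15)),
summed by Lemma 3; the low `m` factors are the Dirichlet-type kernel, whose shifted-grid `ℓ¹` norm
is `≤ m + 2` (`sum_cosProd_zero_shift_le`) — DEVIATION from the paper's expansion (1.16)–(1.17).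
[cite: Bourgain2013MoebiusWalsh, Lemma 5 (1.11)] -/
theorem sum_norm_walshCoeff_le_of_forall_le {n m : ℕ} (A : Finset (Fin n)) (hmn : m ≤ n)
    (hA : ∀ j ∈ A, m ≤ (j : ℕ)) :
    ∑ k ∈ range (2 ^ n), ‖walshCoeff A ((k : ℝ) / 2 ^ n)‖ ≤
      2 * ((m : ℝ) + 2) * (2 : ℝ) ^ (walshL1Exponent * (n - m : ℕ)) := by
  set σ := n - m with hσ
  set u := digitPhaseSeq A with hu
  set uh : ℕ → ℝ := fun i => u (m + i) with huh
  have hn : n = m + σ := by omega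
  have h2n : (2 : ℝ) ^ n = 2 ^ σ * 2 ^ m := by rw [← pow_add, hn, add_comm]
  -- the factorisation `|ŵ_A((k₀ + 2^σ k₁)/2ⁿ)| = D_m((θ + k₁)/2^m) · High(k₀)`, `θ = k₀/2^σ`
  have hfac : ∀ k₀ k₁ : ℕ, ‖walshCoeff A ((((k₀ + 2 ^ σ * k₁ : ℕ) : ℝ)) / 2 ^ n)‖ =
      cosProd (fun _ => 0) m ((((k₀ : ℝ) / 2 ^ σ) + k₁) / 2 ^ m) *
        cosProd uh σ ((k₀ : ℝ) / 2 ^ σ) := by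
    intro k₀ k₁
    rw [norm_walshCoeff_eq_cosProd, cosProd_split u hmn, ← hσ]
    congr 1
    · unfold cosProd
      refine Finset.prod_congr rfl fun i hi => ?_
      rw [Finset.mem_range] at hi
      rw [hu, digitPhaseSeq_eq_zero_of_lt A hA hi, h2n]
      push_cast
      congr 2
      field_simp
    · rw [show (2 : ℝ) ^ m * ((((k₀ + 2 ^ σ * k₁ : ℕ) : ℝ)) / 2 ^ n) = (k₀ : ℝ) / 2 ^ σ + (k₁ : ℕ) by
        rw [h2n]; push_cast; field_simp, cosProd_add_nat]
  have hHi0 : ∀ k₀ : ℕ, 0 ≤ cosProd uh σ ((k₀ : ℝ) / 2 ^ σ) := fun _ => cosProd_nonneg _ _ _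
  calc ∑ k ∈ range (2 ^ n), ‖walshCoeff A ((k : ℝ) / 2 ^ n)‖
      = ∑ k₁ ∈ range (2 ^ m), ∑ k₀ ∈ range (2 ^ σ),
          ‖walshCoeff A ((((k₀ + 2 ^ σ * k₁ : ℕ) : ℝ)) / 2 ^ n)‖ := by
        rw [show 2 ^ n = 2 ^ σ * 2 ^ m by rw [← pow_add, hn, add_comm], sum_range_mul_eq_sum_sum]
    _ = ∑ k₀ ∈ range (2 ^ σ), cosProd uh σ ((k₀ : ℝ) / 2 ^ σ) *
          ∑ k₁ ∈ range (2 ^ m), cosProd (fun _ => 0) m ((((k₀ : ℝ) / 2 ^ σ) + k₁) / 2 ^ m) := by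
        rw [Finset.sum_comm]
        refine Finset.sum_congr rfl fun k₀ _ => ?_
        rw [Finset.mul_sum]
        refine Finset.sum_congr rfl fun k₁ _ => ?_
        rw [hfac, mul_comm]
    _ ≤ ∑ k₀ ∈ range (2 ^ σ), cosProd uh σ ((k₀ : ℝ) / 2 ^ σ) * ((m : ℝ) + 2) := by
        refine Finset.sum_le_sum fun k₀ hk₀ => mul_le_mul_of_nonneg_left ?_ (hHi0 k₀)
        rw [Finset.mem_range] at hk₀
        refine sum_cosProd_zero_shift_le m (by positivity) ?_
        rw [div_le_one (pow_pos two_pos _)]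
        exact_mod_cast hk₀.le
    _ = ((m : ℝ) + 2) * cosProdSum uh σ := by rw [← Finset.sum_mul, mul_comm]; rfl
    _ ≤ ((m : ℝ) + 2) * (2 * (2 : ℝ) ^ (walshL1Exponent * σ)) :=
        mul_le_mul_of_nonneg_left (cosProdSum_le_rpow _ _) (by positivity)
    _ = 2 * ((m : ℝ) + 2) * (2 : ℝ) ^ (walshL1Exponent * (n - m : ℕ)) := by rw [hσ]; ring

end Literature.NumberTheory.LFunctions.MoebiusWalsh
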